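import Literature.Probability.RandomPlanarGeometry.SAWPolygonPathSurgery
import Literature.Probability.RandomPlanarGeometry.SAWWidePolygons
import Literature.Probability.RandomPlanarGeometry.SAWBrickWallHex
import HarnessLib

/-!
# Capless junctions of Madras' join on the honeycomb lattice: one brick, the staggered double brick, the horizontal double brick

Topic `Literature/Probability/RandomPlanarGeometry` (lane «pcv-sawmu», LINE «HEX-MADRAS», a-p4 g13; uses `SAWPolygonPathSurgery.lean`
(`IsPolygon.merge_paths`, `IsPolygon.eq_or_eq_of_mem`), the brick wall `brickWallGraph` of `SAWBrickWallHex.lean` (`brickWallGraph_adj_coord`: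
horizontal unit steps always, the vertical step `(a,b)–(a,b+1)` iff `a + b` is even) and `vertsOf` / `IsPolygon` of the polygon files).

Source frame.  A. Hammond, arXiv:1504.05286v5 [Hammond2015SAPJoining], Definition 4.3 p. 20: the Madras join polygon
`J(τ,σ) = (τ_mod ∪ (σ_mod + T₂e₁)) Δ P¹` across the junction plaquette `P¹` (on `ℤ²`; N. Madras, J. Stat. Phys. 78 (1995) §2).  On the honeycomb
lattice (brick-wall frame) the two polygons `P` (left) and `Q` (right, already translated to first touch with a free column, tree
`HexSAWPolygonJoinSlide.le_of_isFirstTouch` with `g = 2`) are merged capless — WITHOUT modifying either polygon — across a cluster `C` of one or two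
bricks whose boundary meets `P` and `Q` in contiguous paths; the joined polygon is `(P ∪ Q) △ ∂C`, an instance of `IsPolygon.merge_paths`.
This file proves the three junction shapes in coordinates (design note `DESIGN-hex-junctions-v3.md` of the lane):

* `HexBW.brickJoin` / **`HexBW.isPolygon_brickJoin`** — ONE BRICK (contact type T1: the vertical bonds `t – t−(0,1)` of `P` and
  `t+(2,0) – t+(2,−1)` of `Q` face each other; the two middle sites are free): delete the two bonds, add the four horizontal bonds through the
  middle column; a polygon with `#P + #Q + 2` bonds (the tree's one-edge `IsPolygon.merge`).
* `HexBW.staggeredJoin` / **`HexBW.isPolygon_staggeredJoin`** — STAGGERED DOUBLE BRICK (types T2′/T4′: nearest pair in the same row at horizontal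
  distance 3, `P ∋ t – t−(0,1)`, `Q ∋ t+(3,1) – t+(3,0)`): the two bricks `B_t ∪ B_m` sharing the bond `t+(1,0) – t+(2,0)`; the six arc-interior sites
  are free (every near pair is then ≥ 3 columns apart); a polygon with `#P + #Q + 6` bonds.
* `HexBW.hdBoundary`, `HexBW.hdJoin t P Q := (P ∪ Q) △ ∂C″` / **`HexBW.isPolygon_hdJoin`** — HORIZONTAL DOUBLE BRICK (types T3/T5: nearest pair
  at horizontal distance 2 with rows offset by one, no same-row pair at distance 2): the brick with `t` as bottom-middle vertex and the brick with
  `w′ = t+(2,1)` as top-middle vertex, sharing the vertical bond `t+(1,0) – t+(1,1)`; `P ∩ ∂C″` is the path `t, t−(1,0)[, t+(−1,1)]` and `Q ∩ ∂C″`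
  the path `w′, t+(3,1)[, t+(3,0)]` (the optional third vertices join CONTIGUOUSLY by degree two — `forced_bond`), every other site of `∂C″` is
  free; `IsPolygon.merge_paths` in four cases; a polygon with `#P + #Q + 10 − 2(j_P + j_Q)` bonds, `j_P, j_Q ∈ {1,2}`.
* `HexBW.union_symmDiff_eq` — the merge of `IsPolygon.merge_paths` IS Hammond's symmetric difference `(P ∪ Q) △ ∂C`.

Why the horizontal double brick and not the S-shaped triple brick of the lane's earlier design: with `(1,−1) ∈ P` reached through its down-bond the
triple-brick boundary meets `P` NON-contiguously and `(P ∪ Q) △ ∂C` splits into two cycles (explicit `N = 22` witness in the lane's design note v3);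
the horizontal double brick's off-path sites are all pinned by the corridor fact, the selection rule and degree two.  The reflected types T4′/T5
(`t`'s vertical bond pointing up) are the `y ↦ −y` pictures and follow in the companion file.

Consumers (LINE «HEX-MADRAS»): `HexSAWPolygonJoinAssembly.lean` (one-car edition: the junction cover `IsT1…IsT5`/`exists_junction`, the canonicalisation and
the assembly `hexPolygonNumber_le_rpow_of_junctionUnique`), `HexSAWPolygonJunctionUniqueT3/T5.lean` (`hdJoin`/`hdJoin'` decoded), `HexSAWPolygonMadrasExponent.lean`
(θ(ℍ) ≥ 1/2).  Editions: ed.1 8b8b7eff1cd3a193 (T1, T2′, T3); ed.2 ed580d73662f9efc (+ the reflected T4′/T5, shared `adjH`/`adjV`); ed.3 (a-p4 g14) = ed.2 + this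
paragraph (no code change).
-/

noncomputable section

open SimpleGraph Finset Literature.Probability.LatticeModels Literature.Probability.Percolation
open Literature.Probability.Percolation.SiteGadgetSystem (vertsOf mem_vertsOf)

namespace Literature.Probability.RandomPlanarGeometry.SAW

namespace HexBW

/-! ### Coordinates -/

/-- `![a, b] 0 = a`. [folklore] -/
@[simp] private theorem jv0 (a b : ℤ) : (![a, b] : Site 2) 0 = a := rfl
/-- `![a, b] 1 = b`. [folklore] -/
@[simp] private theorem jv1 (a b : ℤ) : (![a, b] : Site 2) 1 = b := rfl

/-- Two sites are equal iff their coordinates are. [folklore] -/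
private theorem site_eq_iff (x y : Site 2) : x = y ↔ x 0 = y 0 ∧ x 1 = y 1 := by
  constructor
  · rintro rfl; exact ⟨rfl, rfl⟩
  · intro h; funext i; fin_cases i; exacts [h.1, h.2]

/-- A horizontal unit step to the right is a brick-wall bond, in offset form. [cite: EntingJensen2009, §7.4.2, Fig. 7.10 (brickwork form of the honeycomb lattice)] -/
private theorem adj_right (t : Site 2) (a b : ℤ) : brickWallGraph.Adj (t + ![a, b]) (t + ![a + 1, b]) := by
  rw [brickWallGraph_adj_coord]; left; simp; omega

/-- Horizontal bond with prescribed offsets. [cite: EntingJensen2009, §7.4.2, Fig. 7.10 (brickwork form of the honeycomb lattice)] -/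
private theorem adjH (t : Site 2) (a b c : ℤ) (h : c = a + 1 ∨ a = c + 1) :
    brickWallGraph.Adj (t + ![a, b]) (t + ![c, b]) := by
  rw [brickWallGraph_adj_coord]; left; simp; omega

/-- Vertical bond with prescribed offsets (parity of the lower site even). [cite: EntingJensen2009, §7.4.2, Fig. 7.10 (brickwork form of the honeycomb lattice)] -/
private theorem adjV (t : Site 2) (a b d : ℤ)
    (h : (d = b + 1 ∧ (t 0 + t 1 + a + b) % 2 = 0) ∨ (b = d + 1 ∧ (t 0 + t 1 + a + d) % 2 = 0)) :
    brickWallGraph.Adj (t + ![a, b]) (t + ![a, d]) := by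
  rw [brickWallGraph_adj_coord]; right
  refine ⟨by simp, ?_⟩
  simp only [Pi.add_apply, jv0, jv1]
  rcases h with ⟨h1, h2⟩ | ⟨h1, h2⟩
  · left; constructor <;> omega
  · right; constructor <;> omega


/-! ### The one-brick junction (type T1) -/

section OneBrick

variable {P Q : Finset (Sym2 (Site 2))} {t : Site 2}

/-- The lower connecting path of the one-brick junction: `t − (0,1) → t + (1,−1) → t + (2,−1)`. [cite: Hammond2015SAPJoining, Definition 4.3 p. 20 (arXiv v5: the junction plaquette)] -/
private def lowPath (t : Site 2) : brickWallGraph.Walk (t + ![0, -1]) (t + ![2, -1]) :=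
  Walk.cons (adj_right t 0 (-1)) (Walk.cons (by simpa using adj_right t 1 (-1)) Walk.nil)

/-- The upper connecting path of the one-brick junction: `t → t + (1,0) → t + (2,0)`. [cite: Hammond2015SAPJoining, Definition 4.3 p. 20 (arXiv v5)] -/
private def upPath (t : Site 2) : brickWallGraph.Walk (t + ![0, 0]) (t + ![2, 0]) :=
  Walk.cons (adj_right t 0 0) (Walk.cons (by simpa using adj_right t 1 0) Walk.nil)

/-- `upPath_support`: support / edge list of a junction arc (private plumbing). [folklore] -/
private theorem upPath_support (t : Site 2) : (upPath t).support = [t + ![0, 0], t + ![1, 0], t + ![2, 0]] := by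
  simp [upPath]

/-- `lowPath_support`: support / edge list of a junction arc (private plumbing). [folklore] -/
private theorem lowPath_support (t : Site 2) : (lowPath t).support = [t + ![0, -1], t + ![1, -1], t + ![2, -1]] := by
  simp [lowPath]

/-- **The one-brick junction** (contact type T1): delete the facing vertical bonds `t – t−(0,1)` of `P` and `t+(2,0) – t+(2,−1)` of `Q`
and add the four horizontal bonds of the brick between them. [cite: Hammond2015SAPJoining, Definition 4.3 p. 20 (arXiv v5: «J(τ,σ) = (τ_mod ∪ (σ_mod + T₂e₁)) Δ P¹», the junction plaquette)] -/
def brickJoin (t : Site 2) (P Q : Finset (Sym2 (Site 2))) : Finset (Sym2 (Site 2)) :=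
  P.erase s(t + ![0, 0], t + ![0, -1]) ∪ Q.erase s(t + ![2, 0], t + ![2, -1]) ∪
    ({s(t + ![0, 0], t + ![1, 0]), s(t + ![1, 0], t + ![2, 0])} ∪ {s(t + ![0, -1], t + ![1, -1]), s(t + ![1, -1], t + ![2, -1])})

/-- `upPath_edges`: support / edge list of a junction arc (private plumbing). [folklore] -/
private theorem upPath_edges (t : Site 2) :
    (upPath t).edges.toFinset = {s(t + ![0, 0], t + ![1, 0]), s(t + ![1, 0], t + ![2, 0])} := by
  simp [upPath]

/-- `lowPath_edges`: support / edge list of a junction arc (private plumbing). [folklore] -/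
private theorem lowPath_edges (t : Site 2) :
    (lowPath t).edges.toFinset = {s(t + ![0, -1], t + ![1, -1]), s(t + ![1, -1], t + ![2, -1])} := by
  simp [lowPath]

/-- distinct offsets give distinct sites. [folklore] -/
private theorem off_ne {t : Site 2} {a b c d : ℤ} (h : a ≠ c ∨ b ≠ d) : t + ![a, b] ≠ t + ![c, d] := by
  intro he
  have h0 := congrArg (fun z : Site 2 => z 0) he
  have h1 := congrArg (fun z : Site 2 => z 1) he
  simp at h0 h1
  omega

/-- **The one-brick junction is a polygon with `#P + #Q + 2` bonds**, provided `P`, `Q` are vertex-disjoint honeycomb polygons containing the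
two facing vertical bonds and the two middle sites `t + (1,0)`, `t + (1,−1)` lie on neither (at a gap-2 first touch this is Madras' corridor fact,
tree `HexSAWPolygonJoinSlide.le_of_isFirstTouch`). [cite: Hammond2015SAPJoining, Definition 4.3 p. 20 (arXiv v5: the junction plaquette); Madras1995LatticeAnimalsExponent, §2] -/
theorem isPolygon_brickJoin (hP : IsPolygon brickWallGraph P) (hQ : IsPolygon brickWallGraph Q)
    (hdisj : ∀ x, x ∈ vertsOf P → x ∈ vertsOf Q → False)
    (het : s(t + ![0, 0], t + ![0, -1]) ∈ P) (hew : s(t + ![2, 0], t + ![2, -1]) ∈ Q)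
    (hm₁P : t + ![1, 0] ∉ vertsOf P) (hm₁Q : t + ![1, 0] ∉ vertsOf Q)
    (hm₂P : t + ![1, -1] ∉ vertsOf P) (hm₂Q : t + ![1, -1] ∉ vertsOf Q) :
    IsPolygon brickWallGraph (brickJoin t P Q) ∧ #(brickJoin t P Q) = #P + #Q + 2 := by
  have hE : ∀ x, (∃ e ∈ P, x ∈ e) → (∃ e ∈ Q, x ∈ e) → False :=
    fun x hx hy => hdisj x (mem_vertsOf.2 hx) (mem_vertsOf.2 hy)
  have ht : t + ![0, 0] ∈ vertsOf P := mem_vertsOf.2 ⟨_, het, by simp⟩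
  have hu : t + ![0, -1] ∈ vertsOf P := mem_vertsOf.2 ⟨_, het, by simp⟩
  have hw : t + ![2, 0] ∈ vertsOf Q := mem_vertsOf.2 ⟨_, hew, by simp⟩
  have hq : t + ![2, -1] ∈ vertsOf Q := mem_vertsOf.2 ⟨_, hew, by simp⟩
  have hR₁ : (upPath t).IsPath := by
    rw [Walk.isPath_def, upPath_support t]
    simp
  have hR₂ : (lowPath t).IsPath := by
    rw [Walk.isPath_def, lowPath_support t]
    simp
  have key := hP.merge hQ het hew hR₁ hR₂ hE
    (fun x hx hxP => by
      rw [upPath_support] at hx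
      simp only [List.mem_cons, List.not_mem_nil, or_false] at hx
      rcases hx with rfl | rfl | rfl
      · rfl
      · exact absurd (mem_vertsOf.2 hxP) hm₁P
      · exact (hdisj _ (mem_vertsOf.2 hxP) hw).elim)
    (fun x hx hxQ => by
      rw [upPath_support] at hx
      simp only [List.mem_cons, List.not_mem_nil, or_false] at hx
      rcases hx with rfl | rfl | rfl
      · exact (hdisj _ ht (mem_vertsOf.2 hxQ)).elim
      · exact absurd (mem_vertsOf.2 hxQ) hm₁Q
      · rfl)
    (fun x hx hxP => by
      rw [lowPath_support] at hx
      simp only [List.mem_cons, List.not_mem_nil, or_false] at hx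
      rcases hx with rfl | rfl | rfl
      · rfl
      · exact absurd (mem_vertsOf.2 hxP) hm₂P
      · exact (hdisj _ (mem_vertsOf.2 hxP) hq).elim)
    (fun x hx hxQ => by
      rw [lowPath_support] at hx
      simp only [List.mem_cons, List.not_mem_nil, or_false] at hx
      rcases hx with rfl | rfl | rfl
      · exact (hdisj _ hu (mem_vertsOf.2 hxQ)).elim
      · exact absurd (mem_vertsOf.2 hxQ) hm₂Q
      · rfl)
    (fun x hx hx' => by
      rw [upPath_support] at hx
      rw [lowPath_support] at hx'
      simp only [List.mem_cons, List.not_mem_nil, or_false] at hx hx'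
      rcases hx with rfl | rfl | rfl <;> rcases hx' with h | h | h <;> exact off_ne (by norm_num) h)
  rw [upPath_edges, lowPath_edges] at key
  have hlen₁ : (upPath t).length = 2 := by simp [upPath]
  have hlen₂ : (lowPath t).length = 2 := by simp [lowPath]
  rw [hlen₁, hlen₂] at key
  refine ⟨key.1, ?_⟩
  have := key.2
  unfold brickJoin
  omega

end OneBrick

/-! ### Neighbours in the brick wall, offset form -/

section Nbrs

variable {t : Site 2}

/-- The brick-wall neighbours of `t + (a,b)` are among `t + (a±1, b)`, `t + (a, b±1)` (coordinate form). [cite: EntingJensen2009, §7.4.2, Fig. 7.10 (brickwork form of the honeycomb lattice)] -/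
private theorem nbr_cases (t : Site 2) (a b : ℤ) {y : Site 2} (h : brickWallGraph.Adj (t + ![a, b]) y) :
    y = t + ![a + 1, b] ∨ y = t + ![a - 1, b] ∨
      (y = t + ![a, b + 1] ∧ (t 0 + t 1 + a + b) % 2 = 0) ∨ (y = t + ![a, b - 1] ∧ (t 0 + t 1 + a + b) % 2 = 1) := by
  rw [brickWallGraph_adj_coord] at h
  simp only [Pi.add_apply, jv0, jv1] at h
  rcases h with ⟨h0 | h0, h1⟩ | ⟨h0, ⟨h1, hp⟩ | ⟨h1, hp⟩⟩
  · left; rw [site_eq_iff]; simp; omega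
  · right; left; rw [site_eq_iff]; simp; omega
  · right; right; left; refine ⟨?_, by omega⟩; rw [site_eq_iff]; simp; omega
  · right; right; right; refine ⟨?_, by omega⟩; rw [site_eq_iff]; simp; omega

/-- a site on an edge of `E` is a vertex of `E` (left slot). [folklore] -/
private theorem vert_left {E : Finset (Sym2 (Site 2))} {v w : Site 2} (h : s(v, w) ∈ E) : v ∈ vertsOf E :=
  mem_vertsOf.2 ⟨_, h, by simp⟩

/-- a site on an edge of `E` is a vertex of `E` (right slot). [folklore] -/
private theorem vert_right {E : Finset (Sym2 (Site 2))} {v w : Site 2} (h : s(v, w) ∈ E) : w ∈ vertsOf E :=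
  mem_vertsOf.2 ⟨_, h, by simp⟩

/-- **Forced bond.**  If `v = t + (a,b)` is a vertex of the honeycomb polygon `E`, one of its (at most three) lattice neighbours `x` is NOT a vertex
of `E`, and `y`, `z` are the other two candidate neighbours, then both bonds `v–y`, `v–z` belong to `E` (degree two).  Coordinate version used
by the junction lemmas: the hypotheses list the three candidates.
[cite: MadrasSlade1993, Definition 3.2.1 p. 62 (every site of a polygon has exactly two polygon bonds)] -/
private theorem forced_bond {E : Finset (Sym2 (Site 2))} (hE : IsPolygon brickWallGraph E) {v x y z : Site 2}
    (hv : v ∈ vertsOf E) (hnb : ∀ w, brickWallGraph.Adj v w → w = x ∨ w = y ∨ w = z) (hx : x ∉ vertsOf E) :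
    s(v, y) ∈ E ∧ s(v, z) ∈ E := by
  obtain ⟨b₁, b₂, hne, h₁, h₂, a₁, a₂⟩ := hE.exists_two_edges (mem_vertsOf.1 hv)
  have c₁ := hnb b₁ a₁
  have c₂ := hnb b₂ a₂
  have hb₁ : b₁ ≠ x := fun h => hx (h ▸ vert_right h₁)
  have hb₂ : b₂ ≠ x := fun h => hx (h ▸ vert_right h₂)
  rcases c₁ with rfl | rfl | rfl
  · exact absurd rfl hb₁
  · rcases c₂ with rfl | rfl | rfl
    · exact absurd rfl hb₂
    · exact absurd rfl hne
    · exact ⟨h₁, h₂⟩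
  · rcases c₂ with rfl | rfl | rfl
    · exact absurd rfl hb₂
    · exact ⟨h₂, h₁⟩
    · exact absurd rfl hne

end Nbrs

/-! ### Symmetric-difference bookkeeping -/

/-- If the face-cluster boundary `B` splits as `A₁ ∪ A₂ ∪ C` with `A₁ ⊆ P` avoiding `Q`, `A₂ ⊆ Q` avoiding `P` and `C` avoiding `P ∪ Q`, then
`(P ∪ Q) △ B = (P ∖ A₁) ∪ (Q ∖ A₂) ∪ C` — the merge of `IsPolygon.merge_paths` IS Hammond's symmetric difference.
[cite: Hammond2015SAPJoining, Definition 4.3 p. 20 (arXiv v5: «(τ_mod ∪ (σ_mod + T₂e₁)) Δ P¹»)] -/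
theorem union_symmDiff_eq {α : Type*} [DecidableEq α] {P Q B A₁ A₂ C : Finset α} (hB : B = A₁ ∪ A₂ ∪ C)
    (h₁ : A₁ ⊆ P) (h₁' : Disjoint A₁ Q) (h₂ : A₂ ⊆ Q) (h₂' : Disjoint A₂ P) (hC : Disjoint C (P ∪ Q)) :
    symmDiff (P ∪ Q) B = P \ A₁ ∪ Q \ A₂ ∪ C := by
  subst hB
  ext x
  simp only [Finset.mem_symmDiff, Finset.mem_union, Finset.mem_sdiff]
  have d1 : x ∈ A₁ → x ∈ Q → False := fun hx hq => Finset.disjoint_left.1 h₁' hx hq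
  have d2 : x ∈ A₂ → x ∈ P → False := fun hx hp => Finset.disjoint_left.1 h₂' hx hp
  have d3 : x ∈ C → x ∈ P ∪ Q → False := fun hx hpq => Finset.disjoint_left.1 hC hx hpq
  have s1 : x ∈ A₁ → x ∈ P := fun h => h₁ h
  have s2 : x ∈ A₂ → x ∈ Q := fun h => h₂ h
  rw [Finset.mem_union] at d3
  tauto

/-! ### The staggered double brick (type T2′: nearest pair in the same row at horizontal distance 3, `t`'s vertical bond down) -/

section Staggered

variable {P Q : Finset (Sym2 (Site 2))} {t : Site 2}

/-- `t → t+(1,0) → t+(1,1) → t+(2,1) → t+(3,1)` (connector; private plumbing). [cite: Hammond2015SAPJoining, Definition 4.3 p. 20 (arXiv v5)] -/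
private def sUpPath (t : Site 2) (h : (t 0 + t 1) % 2 = 1) : brickWallGraph.Walk (t + ![0, 0]) (t + ![3, 1]) :=
  Walk.cons (adjH t 0 0 1 (by norm_num))
    (Walk.cons (adjV t 1 0 1 (Or.inl ⟨by norm_num, by omega⟩))
      (Walk.cons (adjH t 1 1 2 (by norm_num)) (Walk.cons (adjH t 2 1 3 (by norm_num)) Walk.nil)))

/-- `t+(0,-1) → t+(1,-1) → t+(2,-1) → t+(2,0) → t+(3,0)` (connector; private plumbing). [cite: Hammond2015SAPJoining, Definition 4.3 p. 20 (arXiv v5)] -/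
private def sLowPath (t : Site 2) (h : (t 0 + t 1) % 2 = 1) : brickWallGraph.Walk (t + ![0, -1]) (t + ![3, 0]) :=
  Walk.cons (adjH t 0 (-1) 1 (by norm_num))
    (Walk.cons (adjH t 1 (-1) 2 (by norm_num))
      (Walk.cons (adjV t 2 (-1) 0 (Or.inl ⟨by norm_num, by omega⟩)) (Walk.cons (adjH t 2 0 3 (by norm_num)) Walk.nil)))

/-- `sUpPath_support` (private plumbing). [folklore] -/
private theorem sUpPath_support (t : Site 2) (h : (t 0 + t 1) % 2 = 1) :
    (sUpPath t h).support = [t + ![0, 0], t + ![1, 0], t + ![1, 1], t + ![2, 1], t + ![3, 1]] := by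
  simp [sUpPath]

/-- `sLowPath_support` (private plumbing). [folklore] -/
private theorem sLowPath_support (t : Site 2) (h : (t 0 + t 1) % 2 = 1) :
    (sLowPath t h).support = [t + ![0, -1], t + ![1, -1], t + ![2, -1], t + ![2, 0], t + ![3, 0]] := by
  simp [sLowPath]

/-- `sUpPath_edges` (private plumbing). [folklore] -/
private theorem sUpPath_edges (t : Site 2) (h : (t 0 + t 1) % 2 = 1) :
    (sUpPath t h).edges.toFinset =
      {s(t + ![0, 0], t + ![1, 0]), s(t + ![1, 0], t + ![1, 1]), s(t + ![1, 1], t + ![2, 1]), s(t + ![2, 1], t + ![3, 1])} := by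
  simp [sUpPath]

/-- `sLowPath_edges` (private plumbing). [folklore] -/
private theorem sLowPath_edges (t : Site 2) (h : (t 0 + t 1) % 2 = 1) :
    (sLowPath t h).edges.toFinset =
      {s(t + ![0, -1], t + ![1, -1]), s(t + ![1, -1], t + ![2, -1]), s(t + ![2, -1], t + ![2, 0]), s(t + ![2, 0], t + ![3, 0])} := by
  simp [sLowPath]

/-- **The staggered double-brick junction** (contact type T2′): delete the vertical bond `t – t+(0,-1)` of `P` and the vertical bond
`t+(3,1) – t+(3,0)` of `Q`, add the two 4-bond connecting arcs of the boundary of the two bricks `B_t ∪ B_m` (`B_t` with left side `t+(0,-1), t`;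
`B_m` with right side `t+(3,0), t+(3,1)`; they share the bond `t+(1,0) – t+(2,0)`).
[cite: Hammond2015SAPJoining, Definition 4.3 p. 20 (arXiv v5: the junction plaquette; here a two-face cluster)] -/
def staggeredJoin (t : Site 2) (P Q : Finset (Sym2 (Site 2))) : Finset (Sym2 (Site 2)) :=
  P.erase s(t + ![0, 0], t + ![0, -1]) ∪ Q.erase s(t + ![3, 1], t + ![3, 0]) ∪
    ({s(t + ![0, 0], t + ![1, 0]), s(t + ![1, 0], t + ![1, 1]), s(t + ![1, 1], t + ![2, 1]), s(t + ![2, 1], t + ![3, 1])} ∪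
      {s(t + ![0, -1], t + ![1, -1]), s(t + ![1, -1], t + ![2, -1]), s(t + ![2, -1], t + ![2, 0]), s(t + ![2, 0], t + ![3, 0])})

/-- The six interior sites of the two connecting arcs of the staggered double brick (T2′; offsets from `t`). [cite: Hammond2015SAPJoining, Definition 4.3 p. 20 (arXiv v5)] -/
def staggeredFree : List (ℤ × ℤ) := [(1, 0), (1, 1), (2, 1), (1, -1), (2, -1), (2, 0)]

/-- **The staggered double-brick junction is a polygon with `#P + #Q + 6` bonds** (T2′), provided `P`, `Q` are vertex-disjoint honeycomb polygons,
`P ∋ t – t+(0,-1)`, `Q ∋ t+(3,1) – t+(3,0)` (`t₀ + t₁` odd), and the six arc-interior sites `t + (1,0), (1,1), (2,1), (1,-1), (2,-1), (2,0)` lie on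
neither polygon — at a first touch whose nearest pair is at horizontal distance 3 this is automatic (every near pair is then ≥ 3 columns apart).
[cite: Hammond2015SAPJoining, Definition 4.3 p. 20 (arXiv v5); Madras1995LatticeAnimalsExponent, §2] -/
theorem isPolygon_staggeredJoin (hP : IsPolygon brickWallGraph P) (hQ : IsPolygon brickWallGraph Q)
    (hdisj : ∀ x, x ∈ vertsOf P → x ∈ vertsOf Q → False) (hpar : (t 0 + t 1) % 2 = 1)
    (het : s(t + ![0, 0], t + ![0, -1]) ∈ P) (hew : s(t + ![3, 1], t + ![3, 0]) ∈ Q)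
    (hfree : ∀ ab ∈ staggeredFree, t + ![ab.1, ab.2] ∉ vertsOf P ∧ t + ![ab.1, ab.2] ∉ vertsOf Q) :
    IsPolygon brickWallGraph (staggeredJoin t P Q) ∧ #(staggeredJoin t P Q) = #P + #Q + 6 := by
  have hE : ∀ x, (∃ e ∈ P, x ∈ e) → (∃ e ∈ Q, x ∈ e) → False :=
    fun x hx hy => hdisj x (mem_vertsOf.2 hx) (mem_vertsOf.2 hy)
  have ht : t + ![0, 0] ∈ vertsOf P := mem_vertsOf.2 ⟨_, het, by simp⟩
  have hu : t + ![0, -1] ∈ vertsOf P := mem_vertsOf.2 ⟨_, het, by simp⟩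
  have hw : t + ![3, 0] ∈ vertsOf Q := mem_vertsOf.2 ⟨_, hew, by simp⟩
  have hq : t + ![3, 1] ∈ vertsOf Q := mem_vertsOf.2 ⟨_, hew, by simp⟩
  have f10 := hfree (1, 0) (by simp [staggeredFree]); have f11 := hfree (1, 1) (by simp [staggeredFree])
  have f21 := hfree (2, 1) (by simp [staggeredFree]); have f1m := hfree (1, -1) (by simp [staggeredFree])
  have f2m := hfree (2, -1) (by simp [staggeredFree]); have f20 := hfree (2, 0) (by simp [staggeredFree])
  simp only at f10 f11 f21 f1m f2m f20
  have hR₁ : (sUpPath t hpar).IsPath := by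
    rw [Walk.isPath_def, sUpPath_support]
    simp
  have hR₂ : (sLowPath t hpar).IsPath := by
    rw [Walk.isPath_def, sLowPath_support]
    simp
  have key := hP.merge hQ het hew hR₁ hR₂ hE
    (fun x hx hxP => by
      rw [sUpPath_support] at hx
      simp only [List.mem_cons, List.not_mem_nil, or_false] at hx
      rcases hx with rfl | rfl | rfl | rfl | rfl
      · rfl
      · exact absurd (mem_vertsOf.2 hxP) f10.1
      · exact absurd (mem_vertsOf.2 hxP) f11.1
      · exact absurd (mem_vertsOf.2 hxP) f21.1
      · exact (hdisj _ (mem_vertsOf.2 hxP) hq).elim)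
    (fun x hx hxQ => by
      rw [sUpPath_support] at hx
      simp only [List.mem_cons, List.not_mem_nil, or_false] at hx
      rcases hx with rfl | rfl | rfl | rfl | rfl
      · exact (hdisj _ ht (mem_vertsOf.2 hxQ)).elim
      · exact absurd (mem_vertsOf.2 hxQ) f10.2
      · exact absurd (mem_vertsOf.2 hxQ) f11.2
      · exact absurd (mem_vertsOf.2 hxQ) f21.2
      · rfl)
    (fun x hx hxP => by
      rw [sLowPath_support] at hx
      simp only [List.mem_cons, List.not_mem_nil, or_false] at hx
      rcases hx with rfl | rfl | rfl | rfl | rfl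
      · rfl
      · exact absurd (mem_vertsOf.2 hxP) f1m.1
      · exact absurd (mem_vertsOf.2 hxP) f2m.1
      · exact absurd (mem_vertsOf.2 hxP) f20.1
      · exact (hdisj _ (mem_vertsOf.2 hxP) hw).elim)
    (fun x hx hxQ => by
      rw [sLowPath_support] at hx
      simp only [List.mem_cons, List.not_mem_nil, or_false] at hx
      rcases hx with rfl | rfl | rfl | rfl | rfl
      · exact (hdisj _ hu (mem_vertsOf.2 hxQ)).elim
      · exact absurd (mem_vertsOf.2 hxQ) f1m.2
      · exact absurd (mem_vertsOf.2 hxQ) f2m.2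
      · exact absurd (mem_vertsOf.2 hxQ) f20.2
      · rfl)
    (fun x hx hx' => by
      rw [sUpPath_support] at hx
      rw [sLowPath_support] at hx'
      simp only [List.mem_cons, List.not_mem_nil, or_false] at hx hx'
      rcases hx with rfl | rfl | rfl | rfl | rfl <;> rcases hx' with h | h | h | h | h <;> exact off_ne (by norm_num) h)
  rw [sUpPath_edges, sLowPath_edges] at key
  have hlen₁ : (sUpPath t hpar).length = 4 := by simp [sUpPath]
  have hlen₂ : (sLowPath t hpar).length = 4 := by simp [sLowPath]
  rw [hlen₁, hlen₂] at key
  refine ⟨key.1, ?_⟩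
  have := key.2
  unfold staggeredJoin
  omega

end Staggered


/-! ### The staggered double brick, reflected (type T4′: nearest pair in the same row at horizontal distance 3, `t`'s vertical bond up) -/

section StaggeredRefl

variable {P Q : Finset (Sym2 (Site 2))} {t : Site 2}

/-- `t → t+(1,0) → t+(1,-1) → t+(2,-1) → t+(3,-1)` (connector; private plumbing). [cite: Hammond2015SAPJoining, Definition 4.3 p. 20 (arXiv v5)] -/
private def sUpPath' (t : Site 2) (h : (t 0 + t 1) % 2 = 0) : brickWallGraph.Walk (t + ![0, 0]) (t + ![3, -1]) :=
  Walk.cons (adjH t 0 0 1 (by norm_num))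
    (Walk.cons (adjV t 1 0 (-1) (Or.inr ⟨by norm_num, by omega⟩))
      (Walk.cons (adjH t 1 (-1) 2 (by norm_num)) (Walk.cons (adjH t 2 (-1) 3 (by norm_num)) Walk.nil)))

/-- `t+(0,1) → t+(1,1) → t+(2,1) → t+(2,0) → t+(3,0)` (connector; private plumbing). [cite: Hammond2015SAPJoining, Definition 4.3 p. 20 (arXiv v5)] -/
private def sLowPath' (t : Site 2) (h : (t 0 + t 1) % 2 = 0) : brickWallGraph.Walk (t + ![0, 1]) (t + ![3, 0]) :=
  Walk.cons (adjH t 0 1 1 (by norm_num))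
    (Walk.cons (adjH t 1 1 2 (by norm_num))
      (Walk.cons (adjV t 2 1 0 (Or.inr ⟨by norm_num, by omega⟩)) (Walk.cons (adjH t 2 0 3 (by norm_num)) Walk.nil)))

/-- `sUpPath'_support` (private plumbing). [folklore] -/
private theorem sUpPath'_support (t : Site 2) (h : (t 0 + t 1) % 2 = 0) :
    (sUpPath' t h).support = [t + ![0, 0], t + ![1, 0], t + ![1, -1], t + ![2, -1], t + ![3, -1]] := by
  simp [sUpPath']

/-- `sLowPath'_support` (private plumbing). [folklore] -/
private theorem sLowPath'_support (t : Site 2) (h : (t 0 + t 1) % 2 = 0) :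
    (sLowPath' t h).support = [t + ![0, 1], t + ![1, 1], t + ![2, 1], t + ![2, 0], t + ![3, 0]] := by
  simp [sLowPath']

/-- `sUpPath'_edges` (private plumbing). [folklore] -/
private theorem sUpPath'_edges (t : Site 2) (h : (t 0 + t 1) % 2 = 0) :
    (sUpPath' t h).edges.toFinset =
      {s(t + ![0, 0], t + ![1, 0]), s(t + ![1, 0], t + ![1, -1]), s(t + ![1, -1], t + ![2, -1]), s(t + ![2, -1], t + ![3, -1])} := by
  simp [sUpPath']

/-- `sLowPath'_edges` (private plumbing). [folklore] -/
private theorem sLowPath'_edges (t : Site 2) (h : (t 0 + t 1) % 2 = 0) :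
    (sLowPath' t h).edges.toFinset =
      {s(t + ![0, 1], t + ![1, 1]), s(t + ![1, 1], t + ![2, 1]), s(t + ![2, 1], t + ![2, 0]), s(t + ![2, 0], t + ![3, 0])} := by
  simp [sLowPath']

/-- **The staggered double-brick junction** (contact type T4′): delete the vertical bond `t – t+(0,1)` of `P` and the vertical bond
`t+(3,-1) – t+(3,0)` of `Q`, add the two 4-bond connecting arcs of the boundary of the two bricks `B_t ∪ B_m` (`B_t` with left side `t+(0,1), t`;
`B_m` with right side `t+(3,0), t+(3,-1)`; they share the bond `t+(1,0) – t+(2,0)`).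
[cite: Hammond2015SAPJoining, Definition 4.3 p. 20 (arXiv v5: the junction plaquette; here a two-face cluster)] -/
def staggeredJoin' (t : Site 2) (P Q : Finset (Sym2 (Site 2))) : Finset (Sym2 (Site 2)) :=
  P.erase s(t + ![0, 0], t + ![0, 1]) ∪ Q.erase s(t + ![3, -1], t + ![3, 0]) ∪
    ({s(t + ![0, 0], t + ![1, 0]), s(t + ![1, 0], t + ![1, -1]), s(t + ![1, -1], t + ![2, -1]), s(t + ![2, -1], t + ![3, -1])} ∪
      {s(t + ![0, 1], t + ![1, 1]), s(t + ![1, 1], t + ![2, 1]), s(t + ![2, 1], t + ![2, 0]), s(t + ![2, 0], t + ![3, 0])})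

/-- The six interior sites of the two connecting arcs of the staggered double brick (T4′; offsets from `t`). [cite: Hammond2015SAPJoining, Definition 4.3 p. 20 (arXiv v5)] -/
def staggeredFree' : List (ℤ × ℤ) := [(1, 0), (1, -1), (2, -1), (1, 1), (2, 1), (2, 0)]

/-- **The staggered double-brick junction is a polygon with `#P + #Q + 6` bonds** (T4′), provided `P`, `Q` are vertex-disjoint honeycomb polygons,
`P ∋ t – t+(0,1)`, `Q ∋ t+(3,-1) – t+(3,0)` (`t₀ + t₁` even), and the six arc-interior sites `t + (1,0), (1,-1), (2,-1), (1,1), (2,1), (2,0)` lie on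
neither polygon — at a first touch whose nearest pair is at horizontal distance 3 this is automatic (every near pair is then ≥ 3 columns apart).
[cite: Hammond2015SAPJoining, Definition 4.3 p. 20 (arXiv v5); Madras1995LatticeAnimalsExponent, §2] -/
theorem isPolygon_staggeredJoin' (hP : IsPolygon brickWallGraph P) (hQ : IsPolygon brickWallGraph Q)
    (hdisj : ∀ x, x ∈ vertsOf P → x ∈ vertsOf Q → False) (hpar : (t 0 + t 1) % 2 = 0)
    (het : s(t + ![0, 0], t + ![0, 1]) ∈ P) (hew : s(t + ![3, -1], t + ![3, 0]) ∈ Q)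
    (hfree : ∀ ab ∈ staggeredFree', t + ![ab.1, ab.2] ∉ vertsOf P ∧ t + ![ab.1, ab.2] ∉ vertsOf Q) :
    IsPolygon brickWallGraph (staggeredJoin' t P Q) ∧ #(staggeredJoin' t P Q) = #P + #Q + 6 := by
  have hE : ∀ x, (∃ e ∈ P, x ∈ e) → (∃ e ∈ Q, x ∈ e) → False :=
    fun x hx hy => hdisj x (mem_vertsOf.2 hx) (mem_vertsOf.2 hy)
  have ht : t + ![0, 0] ∈ vertsOf P := mem_vertsOf.2 ⟨_, het, by simp⟩
  have hu : t + ![0, 1] ∈ vertsOf P := mem_vertsOf.2 ⟨_, het, by simp⟩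
  have hw : t + ![3, 0] ∈ vertsOf Q := mem_vertsOf.2 ⟨_, hew, by simp⟩
  have hq : t + ![3, -1] ∈ vertsOf Q := mem_vertsOf.2 ⟨_, hew, by simp⟩
  have f10 := hfree (1, 0) (by simp [staggeredFree']); have f11 := hfree (1, -1) (by simp [staggeredFree'])
  have f21 := hfree (2, -1) (by simp [staggeredFree']); have f1m := hfree (1, 1) (by simp [staggeredFree'])
  have f2m := hfree (2, 1) (by simp [staggeredFree']); have f20 := hfree (2, 0) (by simp [staggeredFree'])
  simp only at f10 f11 f21 f1m f2m f20
  have hR₁ : (sUpPath' t hpar).IsPath := by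
    rw [Walk.isPath_def, sUpPath'_support]
    simp
  have hR₂ : (sLowPath' t hpar).IsPath := by
    rw [Walk.isPath_def, sLowPath'_support]
    simp
  have key := hP.merge hQ het hew hR₁ hR₂ hE
    (fun x hx hxP => by
      rw [sUpPath'_support] at hx
      simp only [List.mem_cons, List.not_mem_nil, or_false] at hx
      rcases hx with rfl | rfl | rfl | rfl | rfl
      · rfl
      · exact absurd (mem_vertsOf.2 hxP) f10.1
      · exact absurd (mem_vertsOf.2 hxP) f11.1
      · exact absurd (mem_vertsOf.2 hxP) f21.1
      · exact (hdisj _ (mem_vertsOf.2 hxP) hq).elim)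
    (fun x hx hxQ => by
      rw [sUpPath'_support] at hx
      simp only [List.mem_cons, List.not_mem_nil, or_false] at hx
      rcases hx with rfl | rfl | rfl | rfl | rfl
      · exact (hdisj _ ht (mem_vertsOf.2 hxQ)).elim
      · exact absurd (mem_vertsOf.2 hxQ) f10.2
      · exact absurd (mem_vertsOf.2 hxQ) f11.2
      · exact absurd (mem_vertsOf.2 hxQ) f21.2
      · rfl)
    (fun x hx hxP => by
      rw [sLowPath'_support] at hx
      simp only [List.mem_cons, List.not_mem_nil, or_false] at hx
      rcases hx with rfl | rfl | rfl | rfl | rfl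
      · rfl
      · exact absurd (mem_vertsOf.2 hxP) f1m.1
      · exact absurd (mem_vertsOf.2 hxP) f2m.1
      · exact absurd (mem_vertsOf.2 hxP) f20.1
      · exact (hdisj _ (mem_vertsOf.2 hxP) hw).elim)
    (fun x hx hxQ => by
      rw [sLowPath'_support] at hx
      simp only [List.mem_cons, List.not_mem_nil, or_false] at hx
      rcases hx with rfl | rfl | rfl | rfl | rfl
      · exact (hdisj _ hu (mem_vertsOf.2 hxQ)).elim
      · exact absurd (mem_vertsOf.2 hxQ) f1m.2
      · exact absurd (mem_vertsOf.2 hxQ) f2m.2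
      · exact absurd (mem_vertsOf.2 hxQ) f20.2
      · rfl)
    (fun x hx hx' => by
      rw [sUpPath'_support] at hx
      rw [sLowPath'_support] at hx'
      simp only [List.mem_cons, List.not_mem_nil, or_false] at hx hx'
      rcases hx with rfl | rfl | rfl | rfl | rfl <;> rcases hx' with h | h | h | h | h <;> exact off_ne (by norm_num) h)
  rw [sUpPath'_edges, sLowPath'_edges] at key
  have hlen₁ : (sUpPath' t hpar).length = 4 := by simp [sUpPath']
  have hlen₂ : (sLowPath' t hpar).length = 4 := by simp [sLowPath']
  rw [hlen₁, hlen₂] at key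
  refine ⟨key.1, ?_⟩
  have := key.2
  unfold staggeredJoin'
  omega

end StaggeredRefl


/-! ### The horizontal double brick (type T3: contact at horizontal distance 2, rows offset by +1) -/

section Horizontal

variable {P Q : Finset (Sym2 (Site 2))} {t : Site 2}

/-- The boundary of the horizontal double brick (T3): the brick with `t` as bottom-middle vertex and the brick with `t + (2,1)` as top-middle vertex,
sharing the vertical bond `t+(1,0) – t+(1,1)` (ten bonds; `t₀ + t₁` odd). [cite: Hammond2015SAPJoining, Definition 4.3 p. 20 (arXiv v5: the junction plaquette; here a two-face cluster)] -/
def hdBoundary (t : Site 2) : Finset (Sym2 (Site 2)) :=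
  {s(t + ![0, 0], t + ![-1, 0]), s(t + ![-1, 0], t + ![-1, 1]), s(t + ![-1, 1], t + ![0, 1]), s(t + ![0, 1], t + ![1, 1]),
    s(t + ![1, 1], t + ![2, 1]), s(t + ![3, 1], t + ![2, 1]), s(t + ![3, 0], t + ![3, 1]),
    s(t + ![0, 0], t + ![1, 0]), s(t + ![1, 0], t + ![2, 0]), s(t + ![2, 0], t + ![3, 0])}

/-- **The horizontal double-brick join** `(P ∪ Q) △ ∂C″` (contact type T3). [cite: Hammond2015SAPJoining, Definition 4.3 p. 20 (arXiv v5: «J(τ,σ) = (τ_mod ∪ (σ_mod + T₂e₁)) Δ P¹»)] -/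
def hdJoin (t : Site 2) (P Q : Finset (Sym2 (Site 2))) : Finset (Sym2 (Site 2)) := symmDiff (P ∪ Q) (hdBoundary t)

/-! #### the eight arcs -/

/-- `t → t−(1,0)` (shared with `P`; private plumbing). [cite: Hammond2015SAPJoining, Definition 4.3 p. 20 (arXiv v5)] -/
private def pA (t : Site 2) : brickWallGraph.Walk (t + ![0, 0]) (t + ![-1, 0]) :=
  Walk.cons (adjH t 0 0 (-1) (by norm_num)) Walk.nil

/-- `t → t−(1,0) → t+(−1,1)` (shared with `P`, long case; private plumbing). [cite: Hammond2015SAPJoining, Definition 4.3 p. 20 (arXiv v5)] -/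
private def pB (t : Site 2) (h : (t 0 + t 1) % 2 = 1) : brickWallGraph.Walk (t + ![0, 0]) (t + ![-1, 1]) :=
  Walk.cons (adjH t 0 0 (-1) (by norm_num)) (Walk.cons (adjV t (-1) 0 1 (Or.inl ⟨by norm_num, by omega⟩)) Walk.nil)

/-- `t+(−1,0) → t+(−1,1) → t+(0,1) → t+(1,1) → t+(2,1)` (top connector, short-`P` case; private plumbing). [cite: Hammond2015SAPJoining, Definition 4.3 p. 20 (arXiv v5)] -/
private def rA (t : Site 2) (h : (t 0 + t 1) % 2 = 1) : brickWallGraph.Walk (t + ![-1, 0]) (t + ![2, 1]) :=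
  Walk.cons (adjV t (-1) 0 1 (Or.inl ⟨by norm_num, by omega⟩))
    (Walk.cons (adjH t (-1) 1 0 (by norm_num))
      (Walk.cons (adjH t 0 1 1 (by norm_num)) (Walk.cons (adjH t 1 1 2 (by norm_num)) Walk.nil)))

/-- `t+(−1,1) → t+(0,1) → t+(1,1) → t+(2,1)` (top connector, long-`P` case; private plumbing). [cite: Hammond2015SAPJoining, Definition 4.3 p. 20 (arXiv v5)] -/
private def rB (t : Site 2) : brickWallGraph.Walk (t + ![-1, 1]) (t + ![2, 1]) :=
  Walk.cons (adjH t (-1) 1 0 (by norm_num))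
    (Walk.cons (adjH t 0 1 1 (by norm_num)) (Walk.cons (adjH t 1 1 2 (by norm_num)) Walk.nil))

/-- `t+(3,1) → t+(2,1)` (shared with `Q`; private plumbing). [cite: Hammond2015SAPJoining, Definition 4.3 p. 20 (arXiv v5)] -/
private def qa (t : Site 2) : brickWallGraph.Walk (t + ![3, 1]) (t + ![2, 1]) :=
  Walk.cons (adjH t 3 1 2 (by norm_num)) Walk.nil

/-- `t+(3,0) → t+(3,1) → t+(2,1)` (shared with `Q`, long case; private plumbing). [cite: Hammond2015SAPJoining, Definition 4.3 p. 20 (arXiv v5)] -/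
private def qb (t : Site 2) (h : (t 0 + t 1) % 2 = 1) : brickWallGraph.Walk (t + ![3, 0]) (t + ![2, 1]) :=
  Walk.cons (adjV t 3 0 1 (Or.inl ⟨by norm_num, by omega⟩)) (Walk.cons (adjH t 3 1 2 (by norm_num)) Walk.nil)

/-- `t → t+(1,0) → t+(2,0) → t+(3,0) → t+(3,1)` (bottom connector, short-`Q` case; private plumbing). [cite: Hammond2015SAPJoining, Definition 4.3 p. 20 (arXiv v5)] -/
private def sa (t : Site 2) (h : (t 0 + t 1) % 2 = 1) : brickWallGraph.Walk (t + ![0, 0]) (t + ![3, 1]) :=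
  Walk.cons (adjH t 0 0 1 (by norm_num))
    (Walk.cons (adjH t 1 0 2 (by norm_num))
      (Walk.cons (adjH t 2 0 3 (by norm_num)) (Walk.cons (adjV t 3 0 1 (Or.inl ⟨by norm_num, by omega⟩)) Walk.nil)))

/-- `t → t+(1,0) → t+(2,0) → t+(3,0)` (bottom connector, long-`Q` case; private plumbing). [cite: Hammond2015SAPJoining, Definition 4.3 p. 20 (arXiv v5)] -/
private def sb (t : Site 2) : brickWallGraph.Walk (t + ![0, 0]) (t + ![3, 0]) :=
  Walk.cons (adjH t 0 0 1 (by norm_num)) (Walk.cons (adjH t 1 0 2 (by norm_num)) (Walk.cons (adjH t 2 0 3 (by norm_num)) Walk.nil))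

/-- **The horizontal double-brick junction is a polygon** with `#P + #Q + 10 − 2(j_P + j_Q)` bonds, `j_P, j_Q ∈ {1, 2}` (contact type T3).
Frame: `t₀ + t₁` odd (so `t`'s vertical bond points down); `P ∋ t−(1,0) – t` (the left bond of the contact site `t`), `Q ∋ t+(2,1) – t+(3,1)` (the right
bond of the contact site `w′ = t + (2,1)`); `P`, `Q` vertex-disjoint; FREE sites: `t+(1,0)`, `t+(2,0)`, `t+(0,1)`, `t+(1,1)` on neither polygon,
`t+(3,0) ∉ P`, `t+(−1,1) ∉ Q` — at a gap-2 first touch of type T3 these are Madras' corridor fact (`le_of_isFirstTouch`) plus «no contact pair in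
the same row» (the selection rule) plus degree two.  Then `j_P = 2` iff `t+(−1,1) ∈ P` (its bond to `t−(1,0)` is then forced) and `j_Q = 2` iff
`t+(3,0) ∈ Q` (its bond to `t+(3,1)` is then forced), and `(P ∪ Q) △ ∂C″` is one polygon.
[cite: Hammond2015SAPJoining, Definition 4.3 p. 20 (arXiv v5: the Madras join polygon); Madras1995LatticeAnimalsExponent, §2] -/
theorem isPolygon_hdJoin (hP : IsPolygon brickWallGraph P) (hQ : IsPolygon brickWallGraph Q)
    (hdisj : ∀ x, x ∈ vertsOf P → x ∈ vertsOf Q → False) (hpar : (t 0 + t 1) % 2 = 1)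
    (hl : s(t + ![0, 0], t + ![-1, 0]) ∈ P) (hr : s(t + ![3, 1], t + ![2, 1]) ∈ Q)
    (f10 : t + ![1, 0] ∉ vertsOf P ∧ t + ![1, 0] ∉ vertsOf Q) (f20 : t + ![2, 0] ∉ vertsOf P ∧ t + ![2, 0] ∉ vertsOf Q)
    (f01 : t + ![0, 1] ∉ vertsOf P ∧ t + ![0, 1] ∉ vertsOf Q) (f11 : t + ![1, 1] ∉ vertsOf P ∧ t + ![1, 1] ∉ vertsOf Q)
    (f30 : t + ![3, 0] ∉ vertsOf P) (fm1 : t + ![-1, 1] ∉ vertsOf Q) :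
    IsPolygon brickWallGraph (hdJoin t P Q) ∧
      #(hdJoin t P Q) + 2 * ((if t + ![-1, 1] ∈ vertsOf P then 2 else 1) + (if t + ![3, 0] ∈ vertsOf Q then 2 else 1)) =
        #P + #Q + 10 := by
  classical
  have hE : ∀ x, (∃ e ∈ P, x ∈ e) → (∃ e ∈ Q, x ∈ e) → False :=
    fun x hx hy => hdisj x (mem_vertsOf.2 hx) (mem_vertsOf.2 hy)
  -- vertices on the two polygons and the automatic exclusions
  have tP : t + ![0, 0] ∈ vertsOf P := vert_left hl
  have lP : t + ![-1, 0] ∈ vertsOf P := vert_right hl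
  have wQ : t + ![2, 1] ∈ vertsOf Q := vert_right hr
  have cQ : t + ![3, 1] ∈ vertsOf Q := vert_left hr
  have tQ : t + ![0, 0] ∉ vertsOf Q := fun h => hdisj _ tP h
  have lQ : t + ![-1, 0] ∉ vertsOf Q := fun h => hdisj _ lP h
  have wP : t + ![2, 1] ∉ vertsOf P := fun h => hdisj _ h wQ
  have cP : t + ![3, 1] ∉ vertsOf P := fun h => hdisj _ h cQ
  -- three bonds of `P`, `Q` at least (polygons have ≥ 3 bonds)
  have h3P : 3 ≤ #P := by
    obtain ⟨u, c, hc, rfl⟩ := hP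
    rw [List.toFinset_card_of_nodup hc.edges_nodup, Walk.length_edges]; exact hc.three_le_length
  have h3Q : 3 ≤ #Q := by
    obtain ⟨u, c, hc, rfl⟩ := hQ
    rw [List.toFinset_card_of_nodup hc.edges_nodup, Walk.length_edges]; exact hc.three_le_length
  -- an edge with a free endpoint is in neither polygon
  have nl : ∀ {v w : Site 2}, v ∉ vertsOf P → v ∉ vertsOf Q → s(v, w) ∉ P ∪ Q := fun hvP hvQ h => by
    rcases Finset.mem_union.1 h with h | h
    · exact hvP (vert_left h)
    · exact hvQ (vert_left h)
  have nr : ∀ {v w : Site 2}, w ∉ vertsOf P → w ∉ vertsOf Q → s(v, w) ∉ P ∪ Q := fun hwP hwQ h => by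
    rcases Finset.mem_union.1 h with h | h
    · exact hwP (vert_right h)
    · exact hwQ (vert_right h)
  -- forced bonds in the long cases
  have forcedP : t + ![-1, 1] ∈ vertsOf P → s(t + ![-1, 1], t + ![-1, 0]) ∈ P := fun hv => by
    refine (forced_bond hP (x := t + ![0, 1]) (y := t + ![-2, 1]) (z := t + ![-1, 0]) hv (fun w hw => ?_) f01.1).2
    rcases nbr_cases t (-1) 1 hw with h | h | ⟨h, hp⟩ | ⟨h, -⟩
    · exact Or.inl (by simpa using h)
    · exact Or.inr (Or.inl (by simpa using h))
    · omega
    · exact Or.inr (Or.inr (by simpa using h))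
  have forcedQ : t + ![3, 0] ∈ vertsOf Q → s(t + ![3, 0], t + ![3, 1]) ∈ Q := fun hv => by
    refine (forced_bond hQ (x := t + ![2, 0]) (y := t + ![4, 0]) (z := t + ![3, 1]) hv (fun w hw => ?_) f20.2).2
    rcases nbr_cases t 3 0 hw with h | h | ⟨h, -⟩ | ⟨h, hp⟩
    · exact Or.inr (Or.inl (by simpa using h))
    · exact Or.inl (by simpa using h)
    · exact Or.inr (Or.inr (by simpa using h))
    · omega
  by_cases hB : t + ![-1, 1] ∈ vertsOf P
  · by_cases hb : t + ![3, 0] ∈ vertsOf Q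
    · -- long `P`-path, long `Q`-path
      have hR₁ : (sb t).IsPath := by rw [Walk.isPath_def]; simp [sb]
      have hR₂ : (rB t).IsPath := by rw [Walk.isPath_def]; simp [rB]
      have sR₁ : (sb t).support = [t + ![0, 0], t + ![1, 0], t + ![2, 0], t + ![3, 0]] := by simp [sb]
      have sR₂ : (rB t).support = [t + ![-1, 1], t + ![0, 1], t + ![1, 1], t + ![2, 1]] := by simp [rB]
      have key := hP.merge_paths hQ (p₁ := pB t hpar) (p₂ := qb t hpar) (R₁ := sb t) (R₂ := rB t)
        (by rw [Walk.isPath_def]; simp [pB])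
        (fun e he => by
          simp only [pB, Walk.edges_cons, Walk.edges_nil, List.mem_cons, List.not_mem_nil, or_false] at he
          rcases he with rfl | rfl
          · exact hl
          · rw [Sym2.eq_swap]; exact forcedP hB)
        (by simp [pB]) (by simp only [pB, Walk.length_cons, Walk.length_nil]; omega)
        (by rw [Walk.isPath_def]; simp [qb])
        (fun e he => by
          simp only [qb, Walk.edges_cons, Walk.edges_nil, List.mem_cons, List.not_mem_nil, or_false] at he
          rcases he with rfl | rfl
          · exact forcedQ hb
          · exact hr)
        (by simp [qb]) (by simp only [qb, Walk.length_cons, Walk.length_nil]; omega)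
        hR₁ hR₂ hE
        (fun x hx hxP => by
          rw [sR₁] at hx
          simp only [List.mem_cons, List.not_mem_nil, or_false] at hx
          rcases hx with rfl | rfl | rfl | rfl
          · exact rfl
          · exact absurd (mem_vertsOf.2 hxP) f10.1
          · exact absurd (mem_vertsOf.2 hxP) f20.1
          · exact absurd (mem_vertsOf.2 hxP) f30)
        (fun x hx hxQ => by
          rw [sR₁] at hx
          simp only [List.mem_cons, List.not_mem_nil, or_false] at hx
          rcases hx with rfl | rfl | rfl | rfl
          · exact absurd (mem_vertsOf.2 hxQ) tQ
          · exact absurd (mem_vertsOf.2 hxQ) f10.2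
          · exact absurd (mem_vertsOf.2 hxQ) f20.2
          · exact rfl)
        (fun x hx hxP => by
          rw [sR₂] at hx
          simp only [List.mem_cons, List.not_mem_nil, or_false] at hx
          rcases hx with rfl | rfl | rfl | rfl
          · exact rfl
          · exact absurd (mem_vertsOf.2 hxP) f01.1
          · exact absurd (mem_vertsOf.2 hxP) f11.1
          · exact absurd (mem_vertsOf.2 hxP) wP)
        (fun x hx hxQ => by
          rw [sR₂] at hx
          simp only [List.mem_cons, List.not_mem_nil, or_false] at hx
          rcases hx with rfl | rfl | rfl | rfl
          · exact absurd (mem_vertsOf.2 hxQ) fm1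
          · exact absurd (mem_vertsOf.2 hxQ) f01.2
          · exact absurd (mem_vertsOf.2 hxQ) f11.2
          · exact rfl)
        (fun x hx hx' => by
          rw [sR₁] at hx
          rw [sR₂] at hx'
          simp only [List.mem_cons, List.not_mem_nil, or_false] at hx hx'
          rcases hx with rfl | rfl | rfl | rfl <;> rcases hx' with h | h | h | h <;> exact off_ne (by norm_num) h)
      have hset : hdJoin t P Q =
          P \ (pB t hpar).edges.toFinset ∪ Q \ (qb t hpar).edges.toFinset ∪ ((sb t).edges.toFinset ∪ (rB t).edges.toFinset) := by
        unfold hdJoin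
        refine union_symmDiff_eq ?_ ?_ ?_ ?_ ?_ ?_
        · apply Finset.Subset.antisymm
          · intro e he
            simp only [hdBoundary, Finset.mem_insert, Finset.mem_singleton] at he
            simp only [pB, qb, sb, rB, Walk.edges_cons, Walk.edges_nil, List.toFinset_cons, List.toFinset_nil, Finset.mem_insert, Finset.notMem_empty, or_false, Finset.mem_union]
            rcases he with rfl | rfl | rfl | rfl | rfl | rfl | rfl | rfl | rfl | rfl <;> simp
          · intro e he
            simp only [pB, qb, sb, rB, Walk.edges_cons, Walk.edges_nil, List.toFinset_cons, List.toFinset_nil, Finset.mem_insert, Finset.notMem_empty, or_false, Finset.mem_union] at he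
            simp only [hdBoundary, Finset.mem_insert, Finset.mem_singleton]
            rcases he with ((rfl | rfl) | (rfl | rfl)) | ((rfl | rfl | rfl) | (rfl | rfl | rfl)) <;> simp
        · intro e he
          simp only [pB, Walk.edges_cons, Walk.edges_nil, List.toFinset_cons, List.toFinset_nil, Finset.mem_insert, Finset.notMem_empty, or_false] at he
          rcases he with rfl | rfl
          · exact hl
          · rw [Sym2.eq_swap]; exact forcedP hB
        · rw [Finset.disjoint_left]
          intro e he
          simp only [pB, Walk.edges_cons, Walk.edges_nil, List.toFinset_cons, List.toFinset_nil, Finset.mem_insert, Finset.notMem_empty, or_false] at he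
          rcases he with rfl | rfl
          · exact fun h => tQ (vert_left h)
          · exact fun h => lQ (vert_left h)
        · intro e he
          simp only [qb, Walk.edges_cons, Walk.edges_nil, List.toFinset_cons, List.toFinset_nil, Finset.mem_insert, Finset.notMem_empty, or_false] at he
          rcases he with rfl | rfl
          · exact forcedQ hb
          · exact hr
        · rw [Finset.disjoint_left]
          intro e he
          simp only [qb, Walk.edges_cons, Walk.edges_nil, List.toFinset_cons, List.toFinset_nil, Finset.mem_insert, Finset.notMem_empty, or_false] at he
          rcases he with rfl | rfl
          · exact fun h => cP (vert_right h)
          · exact fun h => cP (vert_left h)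
        · rw [Finset.disjoint_left]
          intro e he
          simp only [sb, rB, Walk.edges_cons, Walk.edges_nil, List.toFinset_cons, List.toFinset_nil, Finset.mem_insert, Finset.notMem_empty, or_false, Finset.mem_union] at he
          rcases he with (rfl | rfl | rfl) | (rfl | rfl | rfl)
          · exact nr f10.1 f10.2
          · exact nl f10.1 f10.2
          · exact nl f20.1 f20.2
          · exact nr f01.1 f01.2
          · exact nl f01.1 f01.2
          · exact nl f11.1 f11.2
      rw [hset]
      refine ⟨key.1, ?_⟩
      have hk := key.2
      have l1 : (pB t hpar).length = 2 := by simp [pB]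
      have l2 : (qb t hpar).length = 2 := by simp [qb]
      have l3 : (sb t).length = 3 := by simp [sb]
      have l4 : (rB t).length = 3 := by simp [rB]
      rw [l1, l2, l3, l4] at hk
      rw [if_pos hB, if_pos hb]
      omega
    · -- long `P`-path, short `Q`-path
      have hR₁ : (sa t hpar).IsPath := by rw [Walk.isPath_def]; simp [sa]
      have hR₂ : (rB t).IsPath := by rw [Walk.isPath_def]; simp [rB]
      have sR₁ : (sa t hpar).support = [t + ![0, 0], t + ![1, 0], t + ![2, 0], t + ![3, 0], t + ![3, 1]] := by simp [sa]
      have sR₂ : (rB t).support = [t + ![-1, 1], t + ![0, 1], t + ![1, 1], t + ![2, 1]] := by simp [rB]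
      have key := hP.merge_paths hQ (p₁ := pB t hpar) (p₂ := qa t) (R₁ := sa t hpar) (R₂ := rB t)
        (by rw [Walk.isPath_def]; simp [pB])
        (fun e he => by
          simp only [pB, Walk.edges_cons, Walk.edges_nil, List.mem_cons, List.not_mem_nil, or_false] at he
          rcases he with rfl | rfl
          · exact hl
          · rw [Sym2.eq_swap]; exact forcedP hB)
        (by simp [pB]) (by simp only [pB, Walk.length_cons, Walk.length_nil]; omega)
        (by rw [Walk.isPath_def]; simp [qa])
        (fun e he => by
          simp only [qa, Walk.edges_cons, Walk.edges_nil, List.mem_cons, List.not_mem_nil, or_false] at he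
          subst he; exact hr)
        (by simp [qa]) (by simp only [qa, Walk.length_cons, Walk.length_nil]; omega)
        hR₁ hR₂ hE
        (fun x hx hxP => by
          rw [sR₁] at hx
          simp only [List.mem_cons, List.not_mem_nil, or_false] at hx
          rcases hx with rfl | rfl | rfl | rfl | rfl
          · exact rfl
          · exact absurd (mem_vertsOf.2 hxP) f10.1
          · exact absurd (mem_vertsOf.2 hxP) f20.1
          · exact absurd (mem_vertsOf.2 hxP) f30
          · exact absurd (mem_vertsOf.2 hxP) cP)
        (fun x hx hxQ => by
          rw [sR₁] at hx
          simp only [List.mem_cons, List.not_mem_nil, or_false] at hx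
          rcases hx with rfl | rfl | rfl | rfl | rfl
          · exact absurd (mem_vertsOf.2 hxQ) tQ
          · exact absurd (mem_vertsOf.2 hxQ) f10.2
          · exact absurd (mem_vertsOf.2 hxQ) f20.2
          · exact absurd (mem_vertsOf.2 hxQ) hb
          · exact rfl)
        (fun x hx hxP => by
          rw [sR₂] at hx
          simp only [List.mem_cons, List.not_mem_nil, or_false] at hx
          rcases hx with rfl | rfl | rfl | rfl
          · exact rfl
          · exact absurd (mem_vertsOf.2 hxP) f01.1
          · exact absurd (mem_vertsOf.2 hxP) f11.1
          · exact absurd (mem_vertsOf.2 hxP) wP)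
        (fun x hx hxQ => by
          rw [sR₂] at hx
          simp only [List.mem_cons, List.not_mem_nil, or_false] at hx
          rcases hx with rfl | rfl | rfl | rfl
          · exact absurd (mem_vertsOf.2 hxQ) fm1
          · exact absurd (mem_vertsOf.2 hxQ) f01.2
          · exact absurd (mem_vertsOf.2 hxQ) f11.2
          · exact rfl)
        (fun x hx hx' => by
          rw [sR₁] at hx
          rw [sR₂] at hx'
          simp only [List.mem_cons, List.not_mem_nil, or_false] at hx hx'
          rcases hx with rfl | rfl | rfl | rfl | rfl <;> rcases hx' with h | h | h | h <;> exact off_ne (by norm_num) h)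
      have hset : hdJoin t P Q =
          P \ (pB t hpar).edges.toFinset ∪ Q \ (qa t).edges.toFinset ∪ ((sa t hpar).edges.toFinset ∪ (rB t).edges.toFinset) := by
        unfold hdJoin
        refine union_symmDiff_eq ?_ ?_ ?_ ?_ ?_ ?_
        · apply Finset.Subset.antisymm
          · intro e he
            simp only [hdBoundary, Finset.mem_insert, Finset.mem_singleton] at he
            simp only [pB, qa, sa, rB, Walk.edges_cons, Walk.edges_nil, List.toFinset_cons, List.toFinset_nil, Finset.mem_insert, Finset.notMem_empty, or_false, Finset.mem_union]
            rcases he with rfl | rfl | rfl | rfl | rfl | rfl | rfl | rfl | rfl | rfl <;> simp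
          · intro e he
            simp only [pB, qa, sa, rB, Walk.edges_cons, Walk.edges_nil, List.toFinset_cons, List.toFinset_nil, Finset.mem_insert, Finset.notMem_empty, or_false, Finset.mem_union] at he
            simp only [hdBoundary, Finset.mem_insert, Finset.mem_singleton]
            rcases he with ((rfl | rfl) | rfl) | ((rfl | rfl | rfl | rfl) | (rfl | rfl | rfl)) <;> simp
        · intro e he
          simp only [pB, Walk.edges_cons, Walk.edges_nil, List.toFinset_cons, List.toFinset_nil, Finset.mem_insert, Finset.notMem_empty, or_false] at he
          rcases he with rfl | rfl
          · exact hl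
          · rw [Sym2.eq_swap]; exact forcedP hB
        · rw [Finset.disjoint_left]
          intro e he
          simp only [pB, Walk.edges_cons, Walk.edges_nil, List.toFinset_cons, List.toFinset_nil, Finset.mem_insert, Finset.notMem_empty, or_false] at he
          rcases he with rfl | rfl
          · exact fun h => tQ (vert_left h)
          · exact fun h => lQ (vert_left h)
        · intro e he
          simp only [qa, Walk.edges_cons, Walk.edges_nil, List.toFinset_cons, List.toFinset_nil, Finset.mem_insert, Finset.notMem_empty, or_false] at he
          subst he; exact hr
        · rw [Finset.disjoint_left]
          intro e he
          simp only [qa, Walk.edges_cons, Walk.edges_nil, List.toFinset_cons, List.toFinset_nil, Finset.mem_insert, Finset.notMem_empty, or_false] at he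
          subst he; exact fun h => cP (vert_left h)
        · rw [Finset.disjoint_left]
          intro e he
          simp only [sa, rB, Walk.edges_cons, Walk.edges_nil, List.toFinset_cons, List.toFinset_nil, Finset.mem_insert, Finset.notMem_empty, or_false, Finset.mem_union] at he
          rcases he with (rfl | rfl | rfl | rfl) | (rfl | rfl | rfl)
          · exact nr f10.1 f10.2
          · exact nl f10.1 f10.2
          · exact nl f20.1 f20.2
          · exact nl f30 hb
          · exact nr f01.1 f01.2
          · exact nl f01.1 f01.2
          · exact nl f11.1 f11.2
      rw [hset]
      refine ⟨key.1, ?_⟩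
      have hk := key.2
      have l1 : (pB t hpar).length = 2 := by simp [pB]
      have l2 : (qa t).length = 1 := by simp [qa]
      have l3 : (sa t hpar).length = 4 := by simp [sa]
      have l4 : (rB t).length = 3 := by simp [rB]
      rw [l1, l2, l3, l4] at hk
      rw [if_pos hB, if_neg hb]
      omega
  · by_cases hb : t + ![3, 0] ∈ vertsOf Q
    · -- short `P`-path, long `Q`-path
      have hR₁ : (sb t).IsPath := by rw [Walk.isPath_def]; simp [sb]
      have hR₂ : (rA t hpar).IsPath := by rw [Walk.isPath_def]; simp [rA]
      have sR₁ : (sb t).support = [t + ![0, 0], t + ![1, 0], t + ![2, 0], t + ![3, 0]] := by simp [sb]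
      have sR₂ : (rA t hpar).support = [t + ![-1, 0], t + ![-1, 1], t + ![0, 1], t + ![1, 1], t + ![2, 1]] := by simp [rA]
      have key := hP.merge_paths hQ (p₁ := pA t) (p₂ := qb t hpar) (R₁ := sb t) (R₂ := rA t hpar)
        (by rw [Walk.isPath_def]; simp [pA])
        (fun e he => by
          simp only [pA, Walk.edges_cons, Walk.edges_nil, List.mem_cons, List.not_mem_nil, or_false] at he
          subst he; exact hl)
        (by simp [pA]) (by simp only [pA, Walk.length_cons, Walk.length_nil]; omega)
        (by rw [Walk.isPath_def]; simp [qb])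
        (fun e he => by
          simp only [qb, Walk.edges_cons, Walk.edges_nil, List.mem_cons, List.not_mem_nil, or_false] at he
          rcases he with rfl | rfl
          · exact forcedQ hb
          · exact hr)
        (by simp [qb]) (by simp only [qb, Walk.length_cons, Walk.length_nil]; omega)
        hR₁ hR₂ hE
        (fun x hx hxP => by
          rw [sR₁] at hx
          simp only [List.mem_cons, List.not_mem_nil, or_false] at hx
          rcases hx with rfl | rfl | rfl | rfl
          · exact rfl
          · exact absurd (mem_vertsOf.2 hxP) f10.1
          · exact absurd (mem_vertsOf.2 hxP) f20.1
          · exact absurd (mem_vertsOf.2 hxP) f30)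
        (fun x hx hxQ => by
          rw [sR₁] at hx
          simp only [List.mem_cons, List.not_mem_nil, or_false] at hx
          rcases hx with rfl | rfl | rfl | rfl
          · exact absurd (mem_vertsOf.2 hxQ) tQ
          · exact absurd (mem_vertsOf.2 hxQ) f10.2
          · exact absurd (mem_vertsOf.2 hxQ) f20.2
          · exact rfl)
        (fun x hx hxP => by
          rw [sR₂] at hx
          simp only [List.mem_cons, List.not_mem_nil, or_false] at hx
          rcases hx with rfl | rfl | rfl | rfl | rfl
          · exact rfl
          · exact absurd (mem_vertsOf.2 hxP) hB
          · exact absurd (mem_vertsOf.2 hxP) f01.1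
          · exact absurd (mem_vertsOf.2 hxP) f11.1
          · exact absurd (mem_vertsOf.2 hxP) wP)
        (fun x hx hxQ => by
          rw [sR₂] at hx
          simp only [List.mem_cons, List.not_mem_nil, or_false] at hx
          rcases hx with rfl | rfl | rfl | rfl | rfl
          · exact absurd (mem_vertsOf.2 hxQ) lQ
          · exact absurd (mem_vertsOf.2 hxQ) fm1
          · exact absurd (mem_vertsOf.2 hxQ) f01.2
          · exact absurd (mem_vertsOf.2 hxQ) f11.2
          · exact rfl)
        (fun x hx hx' => by
          rw [sR₁] at hx
          rw [sR₂] at hx'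
          simp only [List.mem_cons, List.not_mem_nil, or_false] at hx hx'
          rcases hx with rfl | rfl | rfl | rfl <;> rcases hx' with h | h | h | h | h <;> exact off_ne (by norm_num) h)
      have hset : hdJoin t P Q =
          P \ (pA t).edges.toFinset ∪ Q \ (qb t hpar).edges.toFinset ∪ ((sb t).edges.toFinset ∪ (rA t hpar).edges.toFinset) := by
        unfold hdJoin
        refine union_symmDiff_eq ?_ ?_ ?_ ?_ ?_ ?_
        · apply Finset.Subset.antisymm
          · intro e he
            simp only [hdBoundary, Finset.mem_insert, Finset.mem_singleton] at he
            simp only [pA, qb, sb, rA, Walk.edges_cons, Walk.edges_nil, List.toFinset_cons, List.toFinset_nil, Finset.mem_insert, Finset.notMem_empty, or_false, Finset.mem_union]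
            rcases he with rfl | rfl | rfl | rfl | rfl | rfl | rfl | rfl | rfl | rfl <;> simp
          · intro e he
            simp only [pA, qb, sb, rA, Walk.edges_cons, Walk.edges_nil, List.toFinset_cons, List.toFinset_nil, Finset.mem_insert, Finset.notMem_empty, or_false, Finset.mem_union] at he
            simp only [hdBoundary, Finset.mem_insert, Finset.mem_singleton]
            rcases he with (rfl | (rfl | rfl)) | ((rfl | rfl | rfl) | (rfl | rfl | rfl | rfl)) <;> simp
        · intro e he
          simp only [pA, Walk.edges_cons, Walk.edges_nil, List.toFinset_cons, List.toFinset_nil, Finset.mem_insert, Finset.notMem_empty, or_false] at he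
          subst he; exact hl
        · rw [Finset.disjoint_left]
          intro e he
          simp only [pA, Walk.edges_cons, Walk.edges_nil, List.toFinset_cons, List.toFinset_nil, Finset.mem_insert, Finset.notMem_empty, or_false] at he
          subst he; exact fun h => tQ (vert_left h)
        · intro e he
          simp only [qb, Walk.edges_cons, Walk.edges_nil, List.toFinset_cons, List.toFinset_nil, Finset.mem_insert, Finset.notMem_empty, or_false] at he
          rcases he with rfl | rfl
          · exact forcedQ hb
          · exact hr
        · rw [Finset.disjoint_left]
          intro e he
          simp only [qb, Walk.edges_cons, Walk.edges_nil, List.toFinset_cons, List.toFinset_nil, Finset.mem_insert, Finset.notMem_empty, or_false] at he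
          rcases he with rfl | rfl
          · exact fun h => cP (vert_right h)
          · exact fun h => cP (vert_left h)
        · rw [Finset.disjoint_left]
          intro e he
          simp only [sb, rA, Walk.edges_cons, Walk.edges_nil, List.toFinset_cons, List.toFinset_nil, Finset.mem_insert, Finset.notMem_empty, or_false, Finset.mem_union] at he
          rcases he with (rfl | rfl | rfl) | (rfl | rfl | rfl | rfl)
          · exact nr f10.1 f10.2
          · exact nl f10.1 f10.2
          · exact nl f20.1 f20.2
          · exact nr hB fm1
          · exact nr f01.1 f01.2
          · exact nl f01.1 f01.2
          · exact nl f11.1 f11.2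
      rw [hset]
      refine ⟨key.1, ?_⟩
      have hk := key.2
      have l1 : (pA t).length = 1 := by simp [pA]
      have l2 : (qb t hpar).length = 2 := by simp [qb]
      have l3 : (sb t).length = 3 := by simp [sb]
      have l4 : (rA t hpar).length = 4 := by simp [rA]
      rw [l1, l2, l3, l4] at hk
      rw [if_neg hB, if_pos hb]
      omega
    · -- short `P`-path, short `Q`-path
      have hR₁ : (sa t hpar).IsPath := by rw [Walk.isPath_def]; simp [sa]
      have hR₂ : (rA t hpar).IsPath := by rw [Walk.isPath_def]; simp [rA]
      have sR₁ : (sa t hpar).support = [t + ![0, 0], t + ![1, 0], t + ![2, 0], t + ![3, 0], t + ![3, 1]] := by simp [sa]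
      have sR₂ : (rA t hpar).support = [t + ![-1, 0], t + ![-1, 1], t + ![0, 1], t + ![1, 1], t + ![2, 1]] := by simp [rA]
      have key := hP.merge_paths hQ (p₁ := pA t) (p₂ := qa t) (R₁ := sa t hpar) (R₂ := rA t hpar)
        (by rw [Walk.isPath_def]; simp [pA])
        (fun e he => by
          simp only [pA, Walk.edges_cons, Walk.edges_nil, List.mem_cons, List.not_mem_nil, or_false] at he
          subst he; exact hl)
        (by simp [pA]) (by simp only [pA, Walk.length_cons, Walk.length_nil]; omega)
        (by rw [Walk.isPath_def]; simp [qa])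
        (fun e he => by
          simp only [qa, Walk.edges_cons, Walk.edges_nil, List.mem_cons, List.not_mem_nil, or_false] at he
          subst he; exact hr)
        (by simp [qa]) (by simp only [qa, Walk.length_cons, Walk.length_nil]; omega)
        hR₁ hR₂ hE
        (fun x hx hxP => by
          rw [sR₁] at hx
          simp only [List.mem_cons, List.not_mem_nil, or_false] at hx
          rcases hx with rfl | rfl | rfl | rfl | rfl
          · exact rfl
          · exact absurd (mem_vertsOf.2 hxP) f10.1
          · exact absurd (mem_vertsOf.2 hxP) f20.1
          · exact absurd (mem_vertsOf.2 hxP) f30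
          · exact absurd (mem_vertsOf.2 hxP) cP)
        (fun x hx hxQ => by
          rw [sR₁] at hx
          simp only [List.mem_cons, List.not_mem_nil, or_false] at hx
          rcases hx with rfl | rfl | rfl | rfl | rfl
          · exact absurd (mem_vertsOf.2 hxQ) tQ
          · exact absurd (mem_vertsOf.2 hxQ) f10.2
          · exact absurd (mem_vertsOf.2 hxQ) f20.2
          · exact absurd (mem_vertsOf.2 hxQ) hb
          · exact rfl)
        (fun x hx hxP => by
          rw [sR₂] at hx
          simp only [List.mem_cons, List.not_mem_nil, or_false] at hx
          rcases hx with rfl | rfl | rfl | rfl | rfl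
          · exact rfl
          · exact absurd (mem_vertsOf.2 hxP) hB
          · exact absurd (mem_vertsOf.2 hxP) f01.1
          · exact absurd (mem_vertsOf.2 hxP) f11.1
          · exact absurd (mem_vertsOf.2 hxP) wP)
        (fun x hx hxQ => by
          rw [sR₂] at hx
          simp only [List.mem_cons, List.not_mem_nil, or_false] at hx
          rcases hx with rfl | rfl | rfl | rfl | rfl
          · exact absurd (mem_vertsOf.2 hxQ) lQ
          · exact absurd (mem_vertsOf.2 hxQ) fm1
          · exact absurd (mem_vertsOf.2 hxQ) f01.2
          · exact absurd (mem_vertsOf.2 hxQ) f11.2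
          · exact rfl)
        (fun x hx hx' => by
          rw [sR₁] at hx
          rw [sR₂] at hx'
          simp only [List.mem_cons, List.not_mem_nil, or_false] at hx hx'
          rcases hx with rfl | rfl | rfl | rfl | rfl <;> rcases hx' with h | h | h | h | h <;> exact off_ne (by norm_num) h)
      have hset : hdJoin t P Q =
          P \ (pA t).edges.toFinset ∪ Q \ (qa t).edges.toFinset ∪ ((sa t hpar).edges.toFinset ∪ (rA t hpar).edges.toFinset) := by
        unfold hdJoin
        refine union_symmDiff_eq ?_ ?_ ?_ ?_ ?_ ?_
        · apply Finset.Subset.antisymm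
          · intro e he
            simp only [hdBoundary, Finset.mem_insert, Finset.mem_singleton] at he
            simp only [pA, qa, sa, rA, Walk.edges_cons, Walk.edges_nil, List.toFinset_cons, List.toFinset_nil, Finset.mem_insert, Finset.notMem_empty, or_false, Finset.mem_union]
            rcases he with rfl | rfl | rfl | rfl | rfl | rfl | rfl | rfl | rfl | rfl <;> simp
          · intro e he
            simp only [pA, qa, sa, rA, Walk.edges_cons, Walk.edges_nil, List.toFinset_cons, List.toFinset_nil, Finset.mem_insert, Finset.notMem_empty, or_false, Finset.mem_union] at he
            simp only [hdBoundary, Finset.mem_insert, Finset.mem_singleton]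
            rcases he with (rfl | rfl) | ((rfl | rfl | rfl | rfl) | (rfl | rfl | rfl | rfl)) <;> simp
        · intro e he
          simp only [pA, Walk.edges_cons, Walk.edges_nil, List.toFinset_cons, List.toFinset_nil, Finset.mem_insert, Finset.notMem_empty, or_false] at he
          subst he; exact hl
        · rw [Finset.disjoint_left]
          intro e he
          simp only [pA, Walk.edges_cons, Walk.edges_nil, List.toFinset_cons, List.toFinset_nil, Finset.mem_insert, Finset.notMem_empty, or_false] at he
          subst he; exact fun h => tQ (vert_left h)
        · intro e he
          simp only [qa, Walk.edges_cons, Walk.edges_nil, List.toFinset_cons, List.toFinset_nil, Finset.mem_insert, Finset.notMem_empty, or_false] at he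
          subst he; exact hr
        · rw [Finset.disjoint_left]
          intro e he
          simp only [qa, Walk.edges_cons, Walk.edges_nil, List.toFinset_cons, List.toFinset_nil, Finset.mem_insert, Finset.notMem_empty, or_false] at he
          subst he; exact fun h => cP (vert_left h)
        · rw [Finset.disjoint_left]
          intro e he
          simp only [sa, rA, Walk.edges_cons, Walk.edges_nil, List.toFinset_cons, List.toFinset_nil, Finset.mem_insert, Finset.notMem_empty, or_false, Finset.mem_union] at he
          rcases he with (rfl | rfl | rfl | rfl) | (rfl | rfl | rfl | rfl)
          · exact nr f10.1 f10.2
          · exact nl f10.1 f10.2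
          · exact nl f20.1 f20.2
          · exact nl f30 hb
          · exact nr hB fm1
          · exact nr f01.1 f01.2
          · exact nl f01.1 f01.2
          · exact nl f11.1 f11.2
      rw [hset]
      refine ⟨key.1, ?_⟩
      have hk := key.2
      have l1 : (pA t).length = 1 := by simp [pA]
      have l2 : (qa t).length = 1 := by simp [qa]
      have l3 : (sa t hpar).length = 4 := by simp [sa]
      have l4 : (rA t hpar).length = 4 := by simp [rA]
      rw [l1, l2, l3, l4] at hk
      rw [if_neg hB, if_neg hb]
      omega

end Horizontal


/-! ### The horizontal double brick, reflected (type T5: contact at horizontal distance 2, rows offset by −1) -/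

section HorizontalRefl

variable {P Q : Finset (Sym2 (Site 2))} {t : Site 2}

/-- The boundary of the horizontal double brick (T5): the brick with `t` as top-middle vertex and the brick with `t + (2,-1)` as bottom-middle vertex,
sharing the vertical bond `t+(1,0) – t+(1,-1)` (ten bonds; `t₀ + t₁` even). [cite: Hammond2015SAPJoining, Definition 4.3 p. 20 (arXiv v5: the junction plaquette; here a two-face cluster)] -/
def hdBoundary' (t : Site 2) : Finset (Sym2 (Site 2)) :=
  {s(t + ![0, 0], t + ![-1, 0]), s(t + ![-1, 0], t + ![-1, -1]), s(t + ![-1, -1], t + ![0, -1]), s(t + ![0, -1], t + ![1, -1]),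
    s(t + ![1, -1], t + ![2, -1]), s(t + ![3, -1], t + ![2, -1]), s(t + ![3, 0], t + ![3, -1]),
    s(t + ![0, 0], t + ![1, 0]), s(t + ![1, 0], t + ![2, 0]), s(t + ![2, 0], t + ![3, 0])}

/-- **The horizontal double-brick join** `(P ∪ Q) △ ∂C″` (contact type T5). [cite: Hammond2015SAPJoining, Definition 4.3 p. 20 (arXiv v5: «J(τ,σ) = (τ_mod ∪ (σ_mod + T₂e₁)) Δ P¹»)] -/
def hdJoin' (t : Site 2) (P Q : Finset (Sym2 (Site 2))) : Finset (Sym2 (Site 2)) := symmDiff (P ∪ Q) (hdBoundary' t)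

/-! #### the eight arcs -/

/-- `t → t−(1,0)` (shared with `P`; private plumbing). [cite: Hammond2015SAPJoining, Definition 4.3 p. 20 (arXiv v5)] -/
private def pA' (t : Site 2) : brickWallGraph.Walk (t + ![0, 0]) (t + ![-1, 0]) :=
  Walk.cons (adjH t 0 0 (-1) (by norm_num)) Walk.nil

/-- `t → t−(1,0) → t+(−1,-1)` (shared with `P`, long case; private plumbing). [cite: Hammond2015SAPJoining, Definition 4.3 p. 20 (arXiv v5)] -/
private def pB' (t : Site 2) (h : (t 0 + t 1) % 2 = 0) : brickWallGraph.Walk (t + ![0, 0]) (t + ![-1, -1]) :=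
  Walk.cons (adjH t 0 0 (-1) (by norm_num)) (Walk.cons (adjV t (-1) 0 (-1) (Or.inr ⟨by norm_num, by omega⟩)) Walk.nil)

/-- `t+(−1,0) → t+(−1,-1) → t+(0,-1) → t+(1,-1) → t+(2,-1)` (bottom connector, short-`P` case; private plumbing). [cite: Hammond2015SAPJoining, Definition 4.3 p. 20 (arXiv v5)] -/
private def rA' (t : Site 2) (h : (t 0 + t 1) % 2 = 0) : brickWallGraph.Walk (t + ![-1, 0]) (t + ![2, -1]) :=
  Walk.cons (adjV t (-1) 0 (-1) (Or.inr ⟨by norm_num, by omega⟩))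
    (Walk.cons (adjH t (-1) (-1) 0 (by norm_num))
      (Walk.cons (adjH t 0 (-1) 1 (by norm_num)) (Walk.cons (adjH t 1 (-1) 2 (by norm_num)) Walk.nil)))

/-- `t+(−1,-1) → t+(0,-1) → t+(1,-1) → t+(2,-1)` (bottom connector, long-`P` case; private plumbing). [cite: Hammond2015SAPJoining, Definition 4.3 p. 20 (arXiv v5)] -/
private def rB' (t : Site 2) : brickWallGraph.Walk (t + ![-1, -1]) (t + ![2, -1]) :=
  Walk.cons (adjH t (-1) (-1) 0 (by norm_num))
    (Walk.cons (adjH t 0 (-1) 1 (by norm_num)) (Walk.cons (adjH t 1 (-1) 2 (by norm_num)) Walk.nil))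

/-- `t+(3,-1) → t+(2,-1)` (shared with `Q`; private plumbing). [cite: Hammond2015SAPJoining, Definition 4.3 p. 20 (arXiv v5)] -/
private def qa' (t : Site 2) : brickWallGraph.Walk (t + ![3, -1]) (t + ![2, -1]) :=
  Walk.cons (adjH t 3 (-1) 2 (by norm_num)) Walk.nil

/-- `t+(3,0) → t+(3,-1) → t+(2,-1)` (shared with `Q`, long case; private plumbing). [cite: Hammond2015SAPJoining, Definition 4.3 p. 20 (arXiv v5)] -/
private def qb' (t : Site 2) (h : (t 0 + t 1) % 2 = 0) : brickWallGraph.Walk (t + ![3, 0]) (t + ![2, -1]) :=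
  Walk.cons (adjV t 3 0 (-1) (Or.inr ⟨by norm_num, by omega⟩)) (Walk.cons (adjH t 3 (-1) 2 (by norm_num)) Walk.nil)

/-- `t → t+(1,0) → t+(2,0) → t+(3,0) → t+(3,-1)` (top connector, short-`Q` case; private plumbing). [cite: Hammond2015SAPJoining, Definition 4.3 p. 20 (arXiv v5)] -/
private def sa' (t : Site 2) (h : (t 0 + t 1) % 2 = 0) : brickWallGraph.Walk (t + ![0, 0]) (t + ![3, -1]) :=
  Walk.cons (adjH t 0 0 1 (by norm_num))
    (Walk.cons (adjH t 1 0 2 (by norm_num))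
      (Walk.cons (adjH t 2 0 3 (by norm_num)) (Walk.cons (adjV t 3 0 (-1) (Or.inr ⟨by norm_num, by omega⟩)) Walk.nil)))

/-- `t → t+(1,0) → t+(2,0) → t+(3,0)` (top connector, long-`Q` case; private plumbing). [cite: Hammond2015SAPJoining, Definition 4.3 p. 20 (arXiv v5)] -/
private def sb' (t : Site 2) : brickWallGraph.Walk (t + ![0, 0]) (t + ![3, 0]) :=
  Walk.cons (adjH t 0 0 1 (by norm_num)) (Walk.cons (adjH t 1 0 2 (by norm_num)) (Walk.cons (adjH t 2 0 3 (by norm_num)) Walk.nil))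

/-- **The horizontal double-brick junction is a polygon** with `#P + #Q + 10 − 2(j_P + j_Q)` bonds, `j_P, j_Q ∈ {1, 2}` (contact type T5).
Frame: `t₀ + t₁` even (so `t`'s vertical bond points up); `P ∋ t−(1,0) – t` (the left bond of the contact site `t`), `Q ∋ t+(2,-1) – t+(3,-1)` (the right
bond of the contact site `w′ = t + (2,-1)`); `P`, `Q` vertex-disjoint; FREE sites: `t+(1,0)`, `t+(2,0)`, `t+(0,-1)`, `t+(1,-1)` on neither polygon,
`t+(3,0) ∉ P`, `t+(−1,-1) ∉ Q` — at a gap-2 first touch of type T5 these are Madras' corridor fact (`le_of_isFirstTouch`) plus «no contact pair in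
the same row» (the selection rule) plus degree two.  Then `j_P = 2` iff `t+(−1,-1) ∈ P` (its bond to `t−(1,0)` is then forced) and `j_Q = 2` iff
`t+(3,0) ∈ Q` (its bond to `t+(3,-1)` is then forced), and `(P ∪ Q) △ ∂C″` is one polygon.
[cite: Hammond2015SAPJoining, Definition 4.3 p. 20 (arXiv v5: the Madras join polygon); Madras1995LatticeAnimalsExponent, §2] -/
theorem isPolygon_hdJoin' (hP : IsPolygon brickWallGraph P) (hQ : IsPolygon brickWallGraph Q)
    (hdisj : ∀ x, x ∈ vertsOf P → x ∈ vertsOf Q → False) (hpar : (t 0 + t 1) % 2 = 0)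
    (hl : s(t + ![0, 0], t + ![-1, 0]) ∈ P) (hr : s(t + ![3, -1], t + ![2, -1]) ∈ Q)
    (f10 : t + ![1, 0] ∉ vertsOf P ∧ t + ![1, 0] ∉ vertsOf Q) (f20 : t + ![2, 0] ∉ vertsOf P ∧ t + ![2, 0] ∉ vertsOf Q)
    (f01 : t + ![0, -1] ∉ vertsOf P ∧ t + ![0, -1] ∉ vertsOf Q) (f11 : t + ![1, -1] ∉ vertsOf P ∧ t + ![1, -1] ∉ vertsOf Q)
    (f30 : t + ![3, 0] ∉ vertsOf P) (fm1 : t + ![-1, -1] ∉ vertsOf Q) :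
    IsPolygon brickWallGraph (hdJoin' t P Q) ∧
      #(hdJoin' t P Q) + 2 * ((if t + ![-1, -1] ∈ vertsOf P then 2 else 1) + (if t + ![3, 0] ∈ vertsOf Q then 2 else 1)) =
        #P + #Q + 10 := by
  classical
  have hE : ∀ x, (∃ e ∈ P, x ∈ e) → (∃ e ∈ Q, x ∈ e) → False :=
    fun x hx hy => hdisj x (mem_vertsOf.2 hx) (mem_vertsOf.2 hy)
  -- vertices on the two polygons and the automatic exclusions
  have tP : t + ![0, 0] ∈ vertsOf P := vert_left hl
  have lP : t + ![-1, 0] ∈ vertsOf P := vert_right hl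
  have wQ : t + ![2, -1] ∈ vertsOf Q := vert_right hr
  have cQ : t + ![3, -1] ∈ vertsOf Q := vert_left hr
  have tQ : t + ![0, 0] ∉ vertsOf Q := fun h => hdisj _ tP h
  have lQ : t + ![-1, 0] ∉ vertsOf Q := fun h => hdisj _ lP h
  have wP : t + ![2, -1] ∉ vertsOf P := fun h => hdisj _ h wQ
  have cP : t + ![3, -1] ∉ vertsOf P := fun h => hdisj _ h cQ
  -- three bonds of `P`, `Q` at least (polygons have ≥ 3 bonds)
  have h3P : 3 ≤ #P := by
    obtain ⟨u, c, hc, rfl⟩ := hP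
    rw [List.toFinset_card_of_nodup hc.edges_nodup, Walk.length_edges]; exact hc.three_le_length
  have h3Q : 3 ≤ #Q := by
    obtain ⟨u, c, hc, rfl⟩ := hQ
    rw [List.toFinset_card_of_nodup hc.edges_nodup, Walk.length_edges]; exact hc.three_le_length
  -- an edge with a free endpoint is in neither polygon
  have nl : ∀ {v w : Site 2}, v ∉ vertsOf P → v ∉ vertsOf Q → s(v, w) ∉ P ∪ Q := fun hvP hvQ h => by
    rcases Finset.mem_union.1 h with h | h
    · exact hvP (vert_left h)
    · exact hvQ (vert_left h)
  have nr : ∀ {v w : Site 2}, w ∉ vertsOf P → w ∉ vertsOf Q → s(v, w) ∉ P ∪ Q := fun hwP hwQ h => by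
    rcases Finset.mem_union.1 h with h | h
    · exact hwP (vert_right h)
    · exact hwQ (vert_right h)
  -- forced bonds in the long cases
  have forcedP : t + ![-1, -1] ∈ vertsOf P → s(t + ![-1, -1], t + ![-1, 0]) ∈ P := fun hv => by
    refine (forced_bond hP (x := t + ![0, -1]) (y := t + ![-2, -1]) (z := t + ![-1, 0]) hv (fun w hw => ?_) f01.1).2
    rcases nbr_cases t (-1) (-1) hw with h | h | ⟨h, -⟩ | ⟨h, hp⟩
    · exact Or.inl (by simpa using h)
    · exact Or.inr (Or.inl (by simpa using h))
    · exact Or.inr (Or.inr (by simpa using h))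
    · omega
  have forcedQ : t + ![3, 0] ∈ vertsOf Q → s(t + ![3, 0], t + ![3, -1]) ∈ Q := fun hv => by
    refine (forced_bond hQ (x := t + ![2, 0]) (y := t + ![4, 0]) (z := t + ![3, -1]) hv (fun w hw => ?_) f20.2).2
    rcases nbr_cases t 3 0 hw with h | h | ⟨h, hp⟩ | ⟨h, -⟩
    · exact Or.inr (Or.inl (by simpa using h))
    · exact Or.inl (by simpa using h)
    · omega
    · exact Or.inr (Or.inr (by simpa using h))
  by_cases hB : t + ![-1, -1] ∈ vertsOf P
  · by_cases hb : t + ![3, 0] ∈ vertsOf Q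
    · -- long `P`-path, long `Q`-path
      have hR₁ : (sb' t).IsPath := by rw [Walk.isPath_def]; simp [sb']
      have hR₂ : (rB' t).IsPath := by rw [Walk.isPath_def]; simp [rB']
      have sR₁ : (sb' t).support = [t + ![0, 0], t + ![1, 0], t + ![2, 0], t + ![3, 0]] := by simp [sb']
      have sR₂ : (rB' t).support = [t + ![-1, -1], t + ![0, -1], t + ![1, -1], t + ![2, -1]] := by simp [rB']
      have key := hP.merge_paths hQ (p₁ := pB' t hpar) (p₂ := qb' t hpar) (R₁ := sb' t) (R₂ := rB' t)
        (by rw [Walk.isPath_def]; simp [pB'])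
        (fun e he => by
          simp only [pB', Walk.edges_cons, Walk.edges_nil, List.mem_cons, List.not_mem_nil, or_false] at he
          rcases he with rfl | rfl
          · exact hl
          · rw [Sym2.eq_swap]; exact forcedP hB)
        (by simp [pB']) (by simp only [pB', Walk.length_cons, Walk.length_nil]; omega)
        (by rw [Walk.isPath_def]; simp [qb'])
        (fun e he => by
          simp only [qb', Walk.edges_cons, Walk.edges_nil, List.mem_cons, List.not_mem_nil, or_false] at he
          rcases he with rfl | rfl
          · exact forcedQ hb
          · exact hr)
        (by simp [qb']) (by simp only [qb', Walk.length_cons, Walk.length_nil]; omega)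
        hR₁ hR₂ hE
        (fun x hx hxP => by
          rw [sR₁] at hx
          simp only [List.mem_cons, List.not_mem_nil, or_false] at hx
          rcases hx with rfl | rfl | rfl | rfl
          · exact rfl
          · exact absurd (mem_vertsOf.2 hxP) f10.1
          · exact absurd (mem_vertsOf.2 hxP) f20.1
          · exact absurd (mem_vertsOf.2 hxP) f30)
        (fun x hx hxQ => by
          rw [sR₁] at hx
          simp only [List.mem_cons, List.not_mem_nil, or_false] at hx
          rcases hx with rfl | rfl | rfl | rfl
          · exact absurd (mem_vertsOf.2 hxQ) tQ
          · exact absurd (mem_vertsOf.2 hxQ) f10.2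
          · exact absurd (mem_vertsOf.2 hxQ) f20.2
          · exact rfl)
        (fun x hx hxP => by
          rw [sR₂] at hx
          simp only [List.mem_cons, List.not_mem_nil, or_false] at hx
          rcases hx with rfl | rfl | rfl | rfl
          · exact rfl
          · exact absurd (mem_vertsOf.2 hxP) f01.1
          · exact absurd (mem_vertsOf.2 hxP) f11.1
          · exact absurd (mem_vertsOf.2 hxP) wP)
        (fun x hx hxQ => by
          rw [sR₂] at hx
          simp only [List.mem_cons, List.not_mem_nil, or_false] at hx
          rcases hx with rfl | rfl | rfl | rfl
          · exact absurd (mem_vertsOf.2 hxQ) fm1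
          · exact absurd (mem_vertsOf.2 hxQ) f01.2
          · exact absurd (mem_vertsOf.2 hxQ) f11.2
          · exact rfl)
        (fun x hx hx' => by
          rw [sR₁] at hx
          rw [sR₂] at hx'
          simp only [List.mem_cons, List.not_mem_nil, or_false] at hx hx'
          rcases hx with rfl | rfl | rfl | rfl <;> rcases hx' with h | h | h | h <;> exact off_ne (by norm_num) h)
      have hset : hdJoin' t P Q =
          P \ (pB' t hpar).edges.toFinset ∪ Q \ (qb' t hpar).edges.toFinset ∪ ((sb' t).edges.toFinset ∪ (rB' t).edges.toFinset) := by
        unfold hdJoin'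
        refine union_symmDiff_eq ?_ ?_ ?_ ?_ ?_ ?_
        · apply Finset.Subset.antisymm
          · intro e he
            simp only [hdBoundary', Finset.mem_insert, Finset.mem_singleton] at he
            simp only [pB', qb', sb', rB', Walk.edges_cons, Walk.edges_nil, List.toFinset_cons, List.toFinset_nil, Finset.mem_insert, Finset.notMem_empty, or_false, Finset.mem_union]
            rcases he with rfl | rfl | rfl | rfl | rfl | rfl | rfl | rfl | rfl | rfl <;> simp
          · intro e he
            simp only [pB', qb', sb', rB', Walk.edges_cons, Walk.edges_nil, List.toFinset_cons, List.toFinset_nil, Finset.mem_insert, Finset.notMem_empty, or_false, Finset.mem_union] at he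
            simp only [hdBoundary', Finset.mem_insert, Finset.mem_singleton]
            rcases he with ((rfl | rfl) | (rfl | rfl)) | ((rfl | rfl | rfl) | (rfl | rfl | rfl)) <;> simp
        · intro e he
          simp only [pB', Walk.edges_cons, Walk.edges_nil, List.toFinset_cons, List.toFinset_nil, Finset.mem_insert, Finset.notMem_empty, or_false] at he
          rcases he with rfl | rfl
          · exact hl
          · rw [Sym2.eq_swap]; exact forcedP hB
        · rw [Finset.disjoint_left]
          intro e he
          simp only [pB', Walk.edges_cons, Walk.edges_nil, List.toFinset_cons, List.toFinset_nil, Finset.mem_insert, Finset.notMem_empty, or_false] at he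
          rcases he with rfl | rfl
          · exact fun h => tQ (vert_left h)
          · exact fun h => lQ (vert_left h)
        · intro e he
          simp only [qb', Walk.edges_cons, Walk.edges_nil, List.toFinset_cons, List.toFinset_nil, Finset.mem_insert, Finset.notMem_empty, or_false] at he
          rcases he with rfl | rfl
          · exact forcedQ hb
          · exact hr
        · rw [Finset.disjoint_left]
          intro e he
          simp only [qb', Walk.edges_cons, Walk.edges_nil, List.toFinset_cons, List.toFinset_nil, Finset.mem_insert, Finset.notMem_empty, or_false] at he
          rcases he with rfl | rfl
          · exact fun h => cP (vert_right h)
          · exact fun h => cP (vert_left h)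
        · rw [Finset.disjoint_left]
          intro e he
          simp only [sb', rB', Walk.edges_cons, Walk.edges_nil, List.toFinset_cons, List.toFinset_nil, Finset.mem_insert, Finset.notMem_empty, or_false, Finset.mem_union] at he
          rcases he with (rfl | rfl | rfl) | (rfl | rfl | rfl)
          · exact nr f10.1 f10.2
          · exact nl f10.1 f10.2
          · exact nl f20.1 f20.2
          · exact nr f01.1 f01.2
          · exact nl f01.1 f01.2
          · exact nl f11.1 f11.2
      rw [hset]
      refine ⟨key.1, ?_⟩
      have hk := key.2
      have l1 : (pB' t hpar).length = 2 := by simp [pB']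
      have l2 : (qb' t hpar).length = 2 := by simp [qb']
      have l3 : (sb' t).length = 3 := by simp [sb']
      have l4 : (rB' t).length = 3 := by simp [rB']
      rw [l1, l2, l3, l4] at hk
      rw [if_pos hB, if_pos hb]
      omega
    · -- long `P`-path, short `Q`-path
      have hR₁ : (sa' t hpar).IsPath := by rw [Walk.isPath_def]; simp [sa']
      have hR₂ : (rB' t).IsPath := by rw [Walk.isPath_def]; simp [rB']
      have sR₁ : (sa' t hpar).support = [t + ![0, 0], t + ![1, 0], t + ![2, 0], t + ![3, 0], t + ![3, -1]] := by simp [sa']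
      have sR₂ : (rB' t).support = [t + ![-1, -1], t + ![0, -1], t + ![1, -1], t + ![2, -1]] := by simp [rB']
      have key := hP.merge_paths hQ (p₁ := pB' t hpar) (p₂ := qa' t) (R₁ := sa' t hpar) (R₂ := rB' t)
        (by rw [Walk.isPath_def]; simp [pB'])
        (fun e he => by
          simp only [pB', Walk.edges_cons, Walk.edges_nil, List.mem_cons, List.not_mem_nil, or_false] at he
          rcases he with rfl | rfl
          · exact hl
          · rw [Sym2.eq_swap]; exact forcedP hB)
        (by simp [pB']) (by simp only [pB', Walk.length_cons, Walk.length_nil]; omega)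
        (by rw [Walk.isPath_def]; simp [qa'])
        (fun e he => by
          simp only [qa', Walk.edges_cons, Walk.edges_nil, List.mem_cons, List.not_mem_nil, or_false] at he
          subst he; exact hr)
        (by simp [qa']) (by simp only [qa', Walk.length_cons, Walk.length_nil]; omega)
        hR₁ hR₂ hE
        (fun x hx hxP => by
          rw [sR₁] at hx
          simp only [List.mem_cons, List.not_mem_nil, or_false] at hx
          rcases hx with rfl | rfl | rfl | rfl | rfl
          · exact rfl
          · exact absurd (mem_vertsOf.2 hxP) f10.1
          · exact absurd (mem_vertsOf.2 hxP) f20.1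
          · exact absurd (mem_vertsOf.2 hxP) f30
          · exact absurd (mem_vertsOf.2 hxP) cP)
        (fun x hx hxQ => by
          rw [sR₁] at hx
          simp only [List.mem_cons, List.not_mem_nil, or_false] at hx
          rcases hx with rfl | rfl | rfl | rfl | rfl
          · exact absurd (mem_vertsOf.2 hxQ) tQ
          · exact absurd (mem_vertsOf.2 hxQ) f10.2
          · exact absurd (mem_vertsOf.2 hxQ) f20.2
          · exact absurd (mem_vertsOf.2 hxQ) hb
          · exact rfl)
        (fun x hx hxP => by
          rw [sR₂] at hx
          simp only [List.mem_cons, List.not_mem_nil, or_false] at hx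
          rcases hx with rfl | rfl | rfl | rfl
          · exact rfl
          · exact absurd (mem_vertsOf.2 hxP) f01.1
          · exact absurd (mem_vertsOf.2 hxP) f11.1
          · exact absurd (mem_vertsOf.2 hxP) wP)
        (fun x hx hxQ => by
          rw [sR₂] at hx
          simp only [List.mem_cons, List.not_mem_nil, or_false] at hx
          rcases hx with rfl | rfl | rfl | rfl
          · exact absurd (mem_vertsOf.2 hxQ) fm1
          · exact absurd (mem_vertsOf.2 hxQ) f01.2
          · exact absurd (mem_vertsOf.2 hxQ) f11.2
          · exact rfl)
        (fun x hx hx' => by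
          rw [sR₁] at hx
          rw [sR₂] at hx'
          simp only [List.mem_cons, List.not_mem_nil, or_false] at hx hx'
          rcases hx with rfl | rfl | rfl | rfl | rfl <;> rcases hx' with h | h | h | h <;> exact off_ne (by norm_num) h)
      have hset : hdJoin' t P Q =
          P \ (pB' t hpar).edges.toFinset ∪ Q \ (qa' t).edges.toFinset ∪ ((sa' t hpar).edges.toFinset ∪ (rB' t).edges.toFinset) := by
        unfold hdJoin'
        refine union_symmDiff_eq ?_ ?_ ?_ ?_ ?_ ?_
        · apply Finset.Subset.antisymm
          · intro e he
            simp only [hdBoundary', Finset.mem_insert, Finset.mem_singleton] at he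
            simp only [pB', qa', sa', rB', Walk.edges_cons, Walk.edges_nil, List.toFinset_cons, List.toFinset_nil, Finset.mem_insert, Finset.notMem_empty, or_false, Finset.mem_union]
            rcases he with rfl | rfl | rfl | rfl | rfl | rfl | rfl | rfl | rfl | rfl <;> simp
          · intro e he
            simp only [pB', qa', sa', rB', Walk.edges_cons, Walk.edges_nil, List.toFinset_cons, List.toFinset_nil, Finset.mem_insert, Finset.notMem_empty, or_false, Finset.mem_union] at he
            simp only [hdBoundary', Finset.mem_insert, Finset.mem_singleton]
            rcases he with ((rfl | rfl) | rfl) | ((rfl | rfl | rfl | rfl) | (rfl | rfl | rfl)) <;> simp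
        · intro e he
          simp only [pB', Walk.edges_cons, Walk.edges_nil, List.toFinset_cons, List.toFinset_nil, Finset.mem_insert, Finset.notMem_empty, or_false] at he
          rcases he with rfl | rfl
          · exact hl
          · rw [Sym2.eq_swap]; exact forcedP hB
        · rw [Finset.disjoint_left]
          intro e he
          simp only [pB', Walk.edges_cons, Walk.edges_nil, List.toFinset_cons, List.toFinset_nil, Finset.mem_insert, Finset.notMem_empty, or_false] at he
          rcases he with rfl | rfl
          · exact fun h => tQ (vert_left h)
          · exact fun h => lQ (vert_left h)
        · intro e he
          simp only [qa', Walk.edges_cons, Walk.edges_nil, List.toFinset_cons, List.toFinset_nil, Finset.mem_insert, Finset.notMem_empty, or_false] at he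
          subst he; exact hr
        · rw [Finset.disjoint_left]
          intro e he
          simp only [qa', Walk.edges_cons, Walk.edges_nil, List.toFinset_cons, List.toFinset_nil, Finset.mem_insert, Finset.notMem_empty, or_false] at he
          subst he; exact fun h => cP (vert_left h)
        · rw [Finset.disjoint_left]
          intro e he
          simp only [sa', rB', Walk.edges_cons, Walk.edges_nil, List.toFinset_cons, List.toFinset_nil, Finset.mem_insert, Finset.notMem_empty, or_false, Finset.mem_union] at he
          rcases he with (rfl | rfl | rfl | rfl) | (rfl | rfl | rfl)
          · exact nr f10.1 f10.2
          · exact nl f10.1 f10.2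
          · exact nl f20.1 f20.2
          · exact nl f30 hb
          · exact nr f01.1 f01.2
          · exact nl f01.1 f01.2
          · exact nl f11.1 f11.2
      rw [hset]
      refine ⟨key.1, ?_⟩
      have hk := key.2
      have l1 : (pB' t hpar).length = 2 := by simp [pB']
      have l2 : (qa' t).length = 1 := by simp [qa']
      have l3 : (sa' t hpar).length = 4 := by simp [sa']
      have l4 : (rB' t).length = 3 := by simp [rB']
      rw [l1, l2, l3, l4] at hk
      rw [if_pos hB, if_neg hb]
      omega
  · by_cases hb : t + ![3, 0] ∈ vertsOf Q
    · -- short `P`-path, long `Q`-path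
      have hR₁ : (sb' t).IsPath := by rw [Walk.isPath_def]; simp [sb']
      have hR₂ : (rA' t hpar).IsPath := by rw [Walk.isPath_def]; simp [rA']
      have sR₁ : (sb' t).support = [t + ![0, 0], t + ![1, 0], t + ![2, 0], t + ![3, 0]] := by simp [sb']
      have sR₂ : (rA' t hpar).support = [t + ![-1, 0], t + ![-1, -1], t + ![0, -1], t + ![1, -1], t + ![2, -1]] := by simp [rA']
      have key := hP.merge_paths hQ (p₁ := pA' t) (p₂ := qb' t hpar) (R₁ := sb' t) (R₂ := rA' t hpar)
        (by rw [Walk.isPath_def]; simp [pA'])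
        (fun e he => by
          simp only [pA', Walk.edges_cons, Walk.edges_nil, List.mem_cons, List.not_mem_nil, or_false] at he
          subst he; exact hl)
        (by simp [pA']) (by simp only [pA', Walk.length_cons, Walk.length_nil]; omega)
        (by rw [Walk.isPath_def]; simp [qb'])
        (fun e he => by
          simp only [qb', Walk.edges_cons, Walk.edges_nil, List.mem_cons, List.not_mem_nil, or_false] at he
          rcases he with rfl | rfl
          · exact forcedQ hb
          · exact hr)
        (by simp [qb']) (by simp only [qb', Walk.length_cons, Walk.length_nil]; omega)
        hR₁ hR₂ hE
        (fun x hx hxP => by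
          rw [sR₁] at hx
          simp only [List.mem_cons, List.not_mem_nil, or_false] at hx
          rcases hx with rfl | rfl | rfl | rfl
          · exact rfl
          · exact absurd (mem_vertsOf.2 hxP) f10.1
          · exact absurd (mem_vertsOf.2 hxP) f20.1
          · exact absurd (mem_vertsOf.2 hxP) f30)
        (fun x hx hxQ => by
          rw [sR₁] at hx
          simp only [List.mem_cons, List.not_mem_nil, or_false] at hx
          rcases hx with rfl | rfl | rfl | rfl
          · exact absurd (mem_vertsOf.2 hxQ) tQ
          · exact absurd (mem_vertsOf.2 hxQ) f10.2
          · exact absurd (mem_vertsOf.2 hxQ) f20.2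
          · exact rfl)
        (fun x hx hxP => by
          rw [sR₂] at hx
          simp only [List.mem_cons, List.not_mem_nil, or_false] at hx
          rcases hx with rfl | rfl | rfl | rfl | rfl
          · exact rfl
          · exact absurd (mem_vertsOf.2 hxP) hB
          · exact absurd (mem_vertsOf.2 hxP) f01.1
          · exact absurd (mem_vertsOf.2 hxP) f11.1
          · exact absurd (mem_vertsOf.2 hxP) wP)
        (fun x hx hxQ => by
          rw [sR₂] at hx
          simp only [List.mem_cons, List.not_mem_nil, or_false] at hx
          rcases hx with rfl | rfl | rfl | rfl | rfl
          · exact absurd (mem_vertsOf.2 hxQ) lQ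
          · exact absurd (mem_vertsOf.2 hxQ) fm1
          · exact absurd (mem_vertsOf.2 hxQ) f01.2
          · exact absurd (mem_vertsOf.2 hxQ) f11.2
          · exact rfl)
        (fun x hx hx' => by
          rw [sR₁] at hx
          rw [sR₂] at hx'
          simp only [List.mem_cons, List.not_mem_nil, or_false] at hx hx'
          rcases hx with rfl | rfl | rfl | rfl <;> rcases hx' with h | h | h | h | h <;> exact off_ne (by norm_num) h)
      have hset : hdJoin' t P Q =
          P \ (pA' t).edges.toFinset ∪ Q \ (qb' t hpar).edges.toFinset ∪ ((sb' t).edges.toFinset ∪ (rA' t hpar).edges.toFinset) := by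
        unfold hdJoin'
        refine union_symmDiff_eq ?_ ?_ ?_ ?_ ?_ ?_
        · apply Finset.Subset.antisymm
          · intro e he
            simp only [hdBoundary', Finset.mem_insert, Finset.mem_singleton] at he
            simp only [pA', qb', sb', rA', Walk.edges_cons, Walk.edges_nil, List.toFinset_cons, List.toFinset_nil, Finset.mem_insert, Finset.notMem_empty, or_false, Finset.mem_union]
            rcases he with rfl | rfl | rfl | rfl | rfl | rfl | rfl | rfl | rfl | rfl <;> simp
          · intro e he
            simp only [pA', qb', sb', rA', Walk.edges_cons, Walk.edges_nil, List.toFinset_cons, List.toFinset_nil, Finset.mem_insert, Finset.notMem_empty, or_false, Finset.mem_union] at he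
            simp only [hdBoundary', Finset.mem_insert, Finset.mem_singleton]
            rcases he with (rfl | (rfl | rfl)) | ((rfl | rfl | rfl) | (rfl | rfl | rfl | rfl)) <;> simp
        · intro e he
          simp only [pA', Walk.edges_cons, Walk.edges_nil, List.toFinset_cons, List.toFinset_nil, Finset.mem_insert, Finset.notMem_empty, or_false] at he
          subst he; exact hl
        · rw [Finset.disjoint_left]
          intro e he
          simp only [pA', Walk.edges_cons, Walk.edges_nil, List.toFinset_cons, List.toFinset_nil, Finset.mem_insert, Finset.notMem_empty, or_false] at he
          subst he; exact fun h => tQ (vert_left h)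
        · intro e he
          simp only [qb', Walk.edges_cons, Walk.edges_nil, List.toFinset_cons, List.toFinset_nil, Finset.mem_insert, Finset.notMem_empty, or_false] at he
          rcases he with rfl | rfl
          · exact forcedQ hb
          · exact hr
        · rw [Finset.disjoint_left]
          intro e he
          simp only [qb', Walk.edges_cons, Walk.edges_nil, List.toFinset_cons, List.toFinset_nil, Finset.mem_insert, Finset.notMem_empty, or_false] at he
          rcases he with rfl | rfl
          · exact fun h => cP (vert_right h)
          · exact fun h => cP (vert_left h)
        · rw [Finset.disjoint_left]
          intro e he
          simp only [sb', rA', Walk.edges_cons, Walk.edges_nil, List.toFinset_cons, List.toFinset_nil, Finset.mem_insert, Finset.notMem_empty, or_false, Finset.mem_union] at he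
          rcases he with (rfl | rfl | rfl) | (rfl | rfl | rfl | rfl)
          · exact nr f10.1 f10.2
          · exact nl f10.1 f10.2
          · exact nl f20.1 f20.2
          · exact nr hB fm1
          · exact nr f01.1 f01.2
          · exact nl f01.1 f01.2
          · exact nl f11.1 f11.2
      rw [hset]
      refine ⟨key.1, ?_⟩
      have hk := key.2
      have l1 : (pA' t).length = 1 := by simp [pA']
      have l2 : (qb' t hpar).length = 2 := by simp [qb']
      have l3 : (sb' t).length = 3 := by simp [sb']
      have l4 : (rA' t hpar).length = 4 := by simp [rA']
      rw [l1, l2, l3, l4] at hk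
      rw [if_neg hB, if_pos hb]
      omega
    · -- short `P`-path, short `Q`-path
      have hR₁ : (sa' t hpar).IsPath := by rw [Walk.isPath_def]; simp [sa']
      have hR₂ : (rA' t hpar).IsPath := by rw [Walk.isPath_def]; simp [rA']
      have sR₁ : (sa' t hpar).support = [t + ![0, 0], t + ![1, 0], t + ![2, 0], t + ![3, 0], t + ![3, -1]] := by simp [sa']
      have sR₂ : (rA' t hpar).support = [t + ![-1, 0], t + ![-1, -1], t + ![0, -1], t + ![1, -1], t + ![2, -1]] := by simp [rA']
      have key := hP.merge_paths hQ (p₁ := pA' t) (p₂ := qa' t) (R₁ := sa' t hpar) (R₂ := rA' t hpar)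
        (by rw [Walk.isPath_def]; simp [pA'])
        (fun e he => by
          simp only [pA', Walk.edges_cons, Walk.edges_nil, List.mem_cons, List.not_mem_nil, or_false] at he
          subst he; exact hl)
        (by simp [pA']) (by simp only [pA', Walk.length_cons, Walk.length_nil]; omega)
        (by rw [Walk.isPath_def]; simp [qa'])
        (fun e he => by
          simp only [qa', Walk.edges_cons, Walk.edges_nil, List.mem_cons, List.not_mem_nil, or_false] at he
          subst he; exact hr)
        (by simp [qa']) (by simp only [qa', Walk.length_cons, Walk.length_nil]; omega)
        hR₁ hR₂ hE
        (fun x hx hxP => by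
          rw [sR₁] at hx
          simp only [List.mem_cons, List.not_mem_nil, or_false] at hx
          rcases hx with rfl | rfl | rfl | rfl | rfl
          · exact rfl
          · exact absurd (mem_vertsOf.2 hxP) f10.1
          · exact absurd (mem_vertsOf.2 hxP) f20.1
          · exact absurd (mem_vertsOf.2 hxP) f30
          · exact absurd (mem_vertsOf.2 hxP) cP)
        (fun x hx hxQ => by
          rw [sR₁] at hx
          simp only [List.mem_cons, List.not_mem_nil, or_false] at hx
          rcases hx with rfl | rfl | rfl | rfl | rfl
          · exact absurd (mem_vertsOf.2 hxQ) tQ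
          · exact absurd (mem_vertsOf.2 hxQ) f10.2
          · exact absurd (mem_vertsOf.2 hxQ) f20.2
          · exact absurd (mem_vertsOf.2 hxQ) hb
          · exact rfl)
        (fun x hx hxP => by
          rw [sR₂] at hx
          simp only [List.mem_cons, List.not_mem_nil, or_false] at hx
          rcases hx with rfl | rfl | rfl | rfl | rfl
          · exact rfl
          · exact absurd (mem_vertsOf.2 hxP) hB
          · exact absurd (mem_vertsOf.2 hxP) f01.1
          · exact absurd (mem_vertsOf.2 hxP) f11.1
          · exact absurd (mem_vertsOf.2 hxP) wP)
        (fun x hx hxQ => by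
          rw [sR₂] at hx
          simp only [List.mem_cons, List.not_mem_nil, or_false] at hx
          rcases hx with rfl | rfl | rfl | rfl | rfl
          · exact absurd (mem_vertsOf.2 hxQ) lQ
          · exact absurd (mem_vertsOf.2 hxQ) fm1
          · exact absurd (mem_vertsOf.2 hxQ) f01.2
          · exact absurd (mem_vertsOf.2 hxQ) f11.2
          · exact rfl)
        (fun x hx hx' => by
          rw [sR₁] at hx
          rw [sR₂] at hx'
          simp only [List.mem_cons, List.not_mem_nil, or_false] at hx hx'
          rcases hx with rfl | rfl | rfl | rfl | rfl <;> rcases hx' with h | h | h | h | h <;> exact off_ne (by norm_num) h)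
      have hset : hdJoin' t P Q =
          P \ (pA' t).edges.toFinset ∪ Q \ (qa' t).edges.toFinset ∪ ((sa' t hpar).edges.toFinset ∪ (rA' t hpar).edges.toFinset) := by
        unfold hdJoin'
        refine union_symmDiff_eq ?_ ?_ ?_ ?_ ?_ ?_
        · apply Finset.Subset.antisymm
          · intro e he
            simp only [hdBoundary', Finset.mem_insert, Finset.mem_singleton] at he
            simp only [pA', qa', sa', rA', Walk.edges_cons, Walk.edges_nil, List.toFinset_cons, List.toFinset_nil, Finset.mem_insert, Finset.notMem_empty, or_false, Finset.mem_union]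
            rcases he with rfl | rfl | rfl | rfl | rfl | rfl | rfl | rfl | rfl | rfl <;> simp
          · intro e he
            simp only [pA', qa', sa', rA', Walk.edges_cons, Walk.edges_nil, List.toFinset_cons, List.toFinset_nil, Finset.mem_insert, Finset.notMem_empty, or_false, Finset.mem_union] at he
            simp only [hdBoundary', Finset.mem_insert, Finset.mem_singleton]
            rcases he with (rfl | rfl) | ((rfl | rfl | rfl | rfl) | (rfl | rfl | rfl | rfl)) <;> simp
        · intro e he
          simp only [pA', Walk.edges_cons, Walk.edges_nil, List.toFinset_cons, List.toFinset_nil, Finset.mem_insert, Finset.notMem_empty, or_false] at he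
          subst he; exact hl
        · rw [Finset.disjoint_left]
          intro e he
          simp only [pA', Walk.edges_cons, Walk.edges_nil, List.toFinset_cons, List.toFinset_nil, Finset.mem_insert, Finset.notMem_empty, or_false] at he
          subst he; exact fun h => tQ (vert_left h)
        · intro e he
          simp only [qa', Walk.edges_cons, Walk.edges_nil, List.toFinset_cons, List.toFinset_nil, Finset.mem_insert, Finset.notMem_empty, or_false] at he
          subst he; exact hr
        · rw [Finset.disjoint_left]
          intro e he
          simp only [qa', Walk.edges_cons, Walk.edges_nil, List.toFinset_cons, List.toFinset_nil, Finset.mem_insert, Finset.notMem_empty, or_false] at he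
          subst he; exact fun h => cP (vert_left h)
        · rw [Finset.disjoint_left]
          intro e he
          simp only [sa', rA', Walk.edges_cons, Walk.edges_nil, List.toFinset_cons, List.toFinset_nil, Finset.mem_insert, Finset.notMem_empty, or_false, Finset.mem_union] at he
          rcases he with (rfl | rfl | rfl | rfl) | (rfl | rfl | rfl | rfl)
          · exact nr f10.1 f10.2
          · exact nl f10.1 f10.2
          · exact nl f20.1 f20.2
          · exact nl f30 hb
          · exact nr hB fm1
          · exact nr f01.1 f01.2
          · exact nl f01.1 f01.2
          · exact nl f11.1 f11.2
      rw [hset]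
      refine ⟨key.1, ?_⟩
      have hk := key.2
      have l1 : (pA' t).length = 1 := by simp [pA']
      have l2 : (qa' t).length = 1 := by simp [qa']
      have l3 : (sa' t hpar).length = 4 := by simp [sa']
      have l4 : (rA' t hpar).length = 4 := by simp [rA']
      rw [l1, l2, l3, l4] at hk
      rw [if_neg hB, if_neg hb]
      omega

end HorizontalRefl


end HexBW

end Literature.Probability.RandomPlanarGeometry.SAW

end
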